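import Literature.MathematicalPhysics.QuantumFieldTheory.Balaban1983to89.B5Hk163Rate
import Literature.MathematicalPhysics.QuantumFieldTheory.Balaban1983to89.B5QGQ199Rate

/-!
# Bałaban [CMP 95 (1984)] (1.83): the propagator `G = Δ_a⁻¹` at `U = 1` on the torus — the printed
multipliers in KING's physical variables, the zone-centre regroupings (1.87)/(1.88), and the
**η-RATE of every multiplier entering the finite-rank part of `G`** (linear theory, explicit constants)
(v1.1.1, DOCSTRING-ONLY, XREAD journal l.52371 items R1/R2/I1: the sibling fibre modules are credited by
MODULE NAME (`B5Prop11Bound`/`B5Prop11Fiber`, landed by seat pv15-g2 under paper sub-cell B05) instead of the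
sub-cell shorthand «b05»; the exponential-decay locator is
Prop. 1.2 (1.110)–(1.111) p. 35 (render ref1 p019 read as image), not Prop. 1.1 p. 33; residual (iii) re-pointed
to `B5Prop11Inverse`; no declaration changed.)

HONEST FRAMING (cell `pub-balaban`, T⁴ programme, estimate NE2 = U1a «η-rate, linear theory»).  This module
is about ONE explicit finite-dimensional object: the fibre matrix of Bałaban's momentum representation (1.83)
of `G = Δ_a⁻¹` ([Balaban1984PropagatorsI] p. 31) for the TRIVIAL background `U = 1` on a FINITE torus, at a
fixed reduced momentum `p′ ≠ 0`, `η = 1/n`.  Nothing here is infinite-volume, nothing is a mass gap, nothing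
is uniform in a coupling, and nothing in this file is progress on any Clay problem or on the summit
statement of this programme; it is an audit-grade transcription of a printed formula plus elementary
inequalities with OUR constants.  All theorems are tagged `[folklore]`: the mechanism is King's
[King1986] §4 («we successively replace each factor by the corresponding one … and bound the error»,
p. 672), the objects are Bałaban's; the packaging, the constants and the zone-centre book-keeping are ours
and are NOT attributed to either author.  `[cite: …]` tags locate TEXT, never a proof.

WHAT IS PRINTED (renders read by this seat: pp. 31–33 of [Balaban1984PropagatorsI]; pp. 672–673 of
[King1986]).  p. 31: «This gives the solution of Eq. (1.73), so `G = Δ_a⁻¹`. To investigate better the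
operator G we write it in momentum representation:» followed by (1.83), whose fibre at `p′ ≠ 0` is, in the
index `(l, μ)`,
`G_{(l,μ),(l′,ν)} = δ_{μν}[δ_{ll′}/Δ(p′+l) − a·conj(u v_μ)(p′+l)·φ_μ⁻¹(p′)·(u v_μ)(p′+l′)/ (Δ(p′+l)Δ(p′+l′))]`
`  + b(l,μ) · a⁻¹(Σ_λ |∂_{1,λ}(p′)|²/φ_λ(p′))⁻¹ · conj b(l′,ν)`,
`b(l,μ) = [∂_μ(p′+l)conj u(p′+l)/Δ²(p′+l) · (Σ_{l″}|u(p′+l″)|²/Δ²(p′+l″))⁻¹ − a·conj(u v_μ)(p′+l)/Δ(p′+l) · φ_μ⁻¹(p′)∂_{1,μ}(p′)]`,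
with (1.84) «`φ_μ(p′) = 1 + aΣ_{l″}|u(p′+l″)|²|v_μ(p′+l″)|²/Δ(p′+l″)` for `p′ ≠ 0`».  p. 32: (1.85) «has a
limit as `p′ → 0`, `lim Δ₀(p′)φ_μ(p′) = a`, and it is bounded from below and above by positve constants
independent of k and depending on d and a only. From this it follows that the function (1.86)
`Σ_λ|∂_{1,λ}(p′)|²/(Δ₀²(p′)φ_λ(p′))` has the same property, hence also its inverse.»; (1.87) and «Owing to
the cancellation of the terms with `l′ = l`, the above expression can be extended by continuity to
`p′ = 0`»; (1.88) and «Again taking into account the cancellation of the terms with `l″ = l` the above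
expression is well defined by continuity for `p′ = 0`, and we even get an additional factor `Δ₀(p′)`.
Because there are two expressions in square brackets in the considered term, we get the additional factor
`Δ₀²(p′)`. This factor multiplying the function between the square bracket expressions gives an inverse of
the expression (1.86) which is also well defined.»  King p. 672: (4.20) `|u(p′+l+m)| < CΠ_μ|p′_μ||(p′+l+m)_μ|⁻¹`,
(4.21) `|Δ^{(k+n)}(p′)Δ^{η′}(p′+l+m)⁻¹| ≤ C|p′|²|p′+l+m|⁻²`; p. 673: (4.25)
`|(η′)⁻¹[exp[iη′(p′+l)_μ] − 1] − η⁻¹[exp[iη(p′+l)_μ] − 1]| ≤ … ≤ C|p′+l|²L⁻ᵏ`, Lemma 4.4 (4.29)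
`|u_k^η(p′+l) − u_{k+n}^{η′}(p′+l)| ≤ CL^{−γk}|p′+l|^γ|u_k^η(p′+l)|`, «By repeated use of the identity
`xy − zw = 1/2(x−y)(z+w) + 1/2(x+y)(z−w)` …», and (4.31) `|Δ^{η′}(p′+l)⁻¹ − Δ^{η}(p′+l)⁻¹| ≤ CL^{−2k}`.

WHAT IS TYPED HERE (all at `m² = 0`, `U = 1`, level `n ≥ 1`, `η = 1/n`, `a > 0`, `p′ = s` in the punctured
Brillouin zone `|s_ν| ≤ π`, `s ≠ 0`, and `q` a ZONE REPRESENTATIVE of the alias class `p′ + l`,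
`|q_ν| ≤ πn`, `q_ν ≡ s_ν (mod 2π)` — the physical variables of the sibling `B5Hk163Rate`, `IsRep`).
 §1 zone-centre (second-order) leaf rates: `|S^{(N)}(x) − S^{(RN)}(x)| ≤ x⁴/(12N²)`; King's (4.31)
    `|Δ^{(N)}(q)⁻¹ − Δ^{(RN)}(q)⁻¹| ≤ (π²/24)N⁻²` uniformly (from `King1986.latticeSymbol_inv_sub_ref_le`);
    `|u-factor^{(N)}(x) − u-factor^{(RN)}(x)| ≤ (π⁴/192)x²N⁻²` and `||u(p′)|²_{(N)} − |u(p′)|²_{(RN)}| ≤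
    (π⁴/192)|p′|²N⁻²` at the zone centre.
 §2 the printed sub-expressions of (1.83) as functions of `(q, s)`: `xP` (= `conj(u v_μ)/Δ`, the vector of
    the second term), `cX = aφ_μ⁻¹`, `bP` (= `b(l,μ)`), the REGULARISED bracket `bR = b/Δ₀` and coefficient
    `cB = Δ₀²·a⁻¹(Σ_λ|∂_{1,λ}|²/φ_λ)⁻¹ = (a·q₁₈₆)⁻¹` (the printed «additional factor Δ₀²»), the punctured
    sums `S1x = Σ_{l″≠0}|u v_μ|²/Δ`, `S2x = Σ_{l″≠0}|u|²/Δ²`, the curly bracket `BrP` of (1.88) at `l = 0`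
    (divided by `Δ₀²`) and the combined zone-centre diagonal `dZ = (1 + aS1x)/(φ_μΔ(p′))` of (1.87).
 §3 IDENTIFICATION with the typed fibre matrix `B5Prop11Bound.Fiber.G` of `B5Prop11Fiber.balabanFiber`
    (modules landed by the sibling seat pv15-g2 under paper sub-cell B05; v≤1.1 of this docstring used the
    sub-cell shorthand «b05's»; their entries ARE (1.83) by definition): every entry of `G` equals
    `δ_{μν}[δ_{ll′}Δ(q)⁻¹ − cX·xP(q)·conj xP(q′)] + cB·bR(q)·conj bR(q′)` at representatives; the (1.87)
    identity `Δ(p′)⁻¹ − cX|xP(p′)|² = dZ` and the (1.88) identity `bR(p′) = conj D(p′_μ)·ū(p′)·rS` with the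
    real scalar `rS = (Δ₀/Δ(p′))²·ψ₂⁻¹·(Δ₀φ_μ)⁻¹·BrP` are `B5Prop11Bound`'s `Fiber.O00` / `Fiber.b_o_eq` / `Fiber.r_eq`
    transported (no re-proof).
 §4 MAJORANTS with explicit constants (King (4.20)/(4.21) shape; `γ₀ = (4/π²)^{d+2}` is
    `T4GaugeActionRate.gam0`, `U(q) = Π_ν vMaj_ν(q)`, `D(q) = (π²/4)|q|⁻²`): `‖xP(q)‖ ≤ U(q)vMaj_μ(q)D(q)`,
    `0 < cX ≤ Δ₀/γ₀`, `‖bR(q)‖ ≤ bMajA(q)` (aliased form, all `q`), at the centre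
    `‖bR(p′)‖ ≤ |p′_μ|·(1 + a/4 + aπ²d/16)/(aγ₀²)` and `|rS| ≤ (1 + a/4 + aπ²d/16)/(aγ₀²)`,
    `0 < cB ≤ (Δ₀ + a)/a ≤ (4d + a)/a`, `0 < dZ ≤ (1 + a/4)/(aγ₀)`, `|BrP| ≤ 1 + a/4 + aπ²d/16`.
 §5 η-RATES at EQUAL PHYSICAL MOMENTA between levels `N` and `RN` (currency `A·|q|₁/N + B·N⁻²` times the
    majorant, as in the siblings): `xP_rate` (relative rate `((π/2)^{d+1} + π/2 + π³/48)·|q|₁/N`), `cX_rate`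
    (`(4dC_φ/γ₀)N⁻²`), the x-block ENTRY `cX·xP(q)·conj xP(q′)` for ALL pairs of representatives
    (`xEntry_rate`; at `(l,l′) = (0,0)` the majorant is not uniform in `p′`, see (v)), `bR_rate_alias`
    (`Ab·|q|₁/N + Bb·N⁻²`, all `q`), `cB_rate` (`(4dC_φ/γ₀²)N⁻²`), the rank-one ENTRY `cB·bR(q)·conj bR(q′)`
    from any bracket majorants/rates (`rankOne_rate_of`) and in the aliased form (`rankOne_rate_alias`);
    at the zone centre, second order through §1 (no pairing needed): `T0_rate` (`(π⁶/384 + π²/24)N⁻²`),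
    `S1x_rate` (`CS1·N⁻²`, `CS1 = C_φ + π⁶/384 + π²/24`), `inv_D0phi_rate`, `dZ_rate` — the (0,0) x-block
    entry in its printed (1.87) form is `O(N⁻²)` with a constant depending on `d, a` only —, the centre
    rate of `Δ(p′)` (`|p′|⁴/(12N²)`), `DS2x_rate` (`|Δ^{(N)}S₂^{(N)} − Δ^{(RN)}S₂^{(RN)}| ≤ CW·N⁻²`,
    `CW = π⁴/192 + (π²/4)C_ψ + π⁶/768 + π²/24`, through the printed (1.63)-rate `B5ActionRate166.Psi_rate`),
    `BrP_rate` (`a·CBr·N⁻²`), `ratioSq_rate`, `rS_rate` (`CrS(d, a, Δ₀)·N⁻²`, `CrS` monotone in `Δ₀ ≤ 4d`),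
    and `bR_zero_rate`: the centre bracket in its (1.88) form has relative rate
    `(1 + (π/2)^{d+1})·|p′|₁/N + (CrS/MrS)·N⁻²` against `|p′_μ|·MrS`; whence the rank-one ENTRY rates at
    `(0,0)`, `(0,l′)`, `(l,0)` (`rankOne_rate_zero_zero`, `rankOne_rate_zero_alias`, `rankOne_rate_alias_zero`).
    So EVERY ENTRY of the finite-rank part of (1.83) — x-block and rank-one, every pair of aliases including
    the zone centre — has a typed majorant and a typed η-rate here (the (0,0) x-entry as `dZ`).
 Every hypothesis of every theorem is `1 ≤ N`, `1 ≤ R`, `0 < a` and the zone conditions; there is NO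
 perturbative / background / (B), (B^μ) / `BetaPertH` conditional anywhere in this file (linear theory,
 `U = 1`).

WHAT IS NOT CLAIMED (typed residuals, owners wanted — see the cell records): (i) the SUMS over aliases
`l, l′` of these entries and the position-space kernels (the sibling `B5Hk163RateSum` engine applies to the
majorants `xMaj·xMaj′`, `bMajA·bMajA′`, which carry King's `Π|p′_μ||q_μ|⁻¹` on each side; not done here);
(ii) the FREE diagonal `δ_{ll′}δ_{μν}/Δ(p′+l)`, `l ≠ 0`, whose kernel-level rate is the lattice Green's
function engine (its per-mode rate is §1's (4.31)); (iii) the operator identification of `Fiber.G` with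
`Δ_a⁻¹` on `L²(T_η)` ((1.73)–(1.82), (1.93)–(1.98)) — IN THE TREE at fibre/operator level in the sibling
modules `B5Prop11Inverse` (`G_eq_inv_balaban`, `calG_eq_inv`) and `B5Prop11Plancherel`, not re-derived
here; (iv) the exponential decay of Prop. 1.2 ((1.110)–(1.111) p. 35, § F; Prop. 1.1 p. 33 is the `L²` bound
(1.89)–(1.90), NOT a decay statement) and everything about `U ≠ 1`, (1.99) and the later papers; (v) uniformity of the (0,0) x-entry:
the bound `(Δ₀/γ₀)·xMaj(p′)²` is NOT uniform as `p′ → 0` — that entry is (1.87)'s `dZ`, typed separately,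
exactly as printed.
-/

noncomputable section

namespace Literature.MathematicalPhysics.QuantumFieldTheory.Balaban1983to89.B5G183Rate

open scoped BigOperators ComplexConjugate
open Finset Complex
open Literature.MathematicalPhysics.QuantumFieldTheory.Balaban1983to89.B4Strip
open Literature.MathematicalPhysics.QuantumFieldTheory.Balaban1983to89.B5Prop11Leaves
open Literature.MathematicalPhysics.QuantumFieldTheory.Balaban1983to89.B5Prop11Fiber
open Literature.MathematicalPhysics.QuantumFieldTheory.Balaban1983to89.B5Prop11Bound (Fiber)
open Literature.MathematicalPhysics.QuantumFieldTheory.Balaban1983to89.B5Bounds167Lattice (phi162)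
open Literature.MathematicalPhysics.QuantumFieldTheory.Balaban1983to89.B5ActionRate166 (psiSum Cphi Cpsi)
open Literature.MathematicalPhysics.QuantumFieldTheory.Balaban1983to89.B5QGQ199Rate (sigma199)
open Literature.MathematicalPhysics.QuantumFieldTheory.Balaban1983to89.B5Hk163Rate
open Literature.MathematicalPhysics.QuantumFieldTheory.King1986 (fdq uFac uWeight momSq)

variable {d : ℕ}

/-! ## §1 Zone-centre (second-order) leaf rates -/

section Centre

variable {N R : ℕ}

/-- `η_{RN}² ≤ η_N²`. [folklore] -/
theorem inv_RN_sq_le (hN : 1 ≤ N) (hR : 1 ≤ R) : (((R * N : ℕ) : ℝ)⁻¹) ^ 2 ≤ ((N : ℝ)⁻¹) ^ 2 := by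
  have hN' : (0 : ℝ) < N := by exact_mod_cast hN
  have hR' : (1 : ℝ) ≤ R := by exact_mod_cast hR
  have h : ((R * N : ℕ) : ℝ)⁻¹ ≤ (N : ℝ)⁻¹ := by
    apply inv_anti₀ hN'
    push_cast
    nlinarith
  exact pow_le_pow_left₀ (by positivity) h 2

/-- both `S^{(N)}(x)` and `S^{(RN)}(x)` lie in `[x² − x⁴/(12N²), x²]` on the zone `|x| ≤ πN`, hence
`|S^{(N)}(x) − S^{(RN)}(x)| ≤ x⁴/(12N²)` (the coordinate form of King's (4.10)/(4.31)).
[cite: King1986, (4.10) p.671, (4.31) p.673] [folklore] -/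
theorem Sxir_sub_le_quartic (hN : 1 ≤ N) (hR : 1 ≤ R) {x : ℝ} (hx : |x| ≤ Real.pi * N) :
    |Sxir N x - Sxir (R * N) x| ≤ x ^ 4 / (12 * (N : ℝ) ^ 2) := by
  have hN0 : N ≠ 0 := by omega
  have hRN0 : R * N ≠ 0 := Nat.mul_ne_zero (by omega) hN0
  have hN' : (0 : ℝ) < N := by exact_mod_cast Nat.pos_of_ne_zero hN0
  have hRN' : (0 : ℝ) < ((R * N : ℕ) : ℝ) := by exact_mod_cast Nat.pos_of_ne_zero hRN0
  rw [King1986.Sxir_eq_fdSymbol hN0, King1986.Sxir_eq_fdSymbol hRN0]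
  have hzN : |(N : ℝ)⁻¹ * x| ≤ Real.pi := zone_eta hN hx
  have hzRN : |((R * N : ℕ) : ℝ)⁻¹ * x| ≤ Real.pi := zone_eta (one_le_RN hN hR) (zone_RN hR hx)
  have u1 := King1986.fdSymbol_le_sq (inv_ne_zero hN'.ne') x
  have u2 := King1986.fdSymbol_le_sq (inv_ne_zero hRN'.ne') x
  have l1 := King1986.fdSymbol_ge_quartic (inv_ne_zero hN'.ne') hzN
  have l2 := King1986.fdSymbol_ge_quartic (inv_ne_zero hRN'.ne') hzRN
  have hx4 : 0 ≤ x ^ 4 := by positivity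
  have hη2 : (((R * N : ℕ) : ℝ)⁻¹) ^ 2 / 12 * x ^ 4 ≤ ((N : ℝ)⁻¹) ^ 2 / 12 * x ^ 4 :=
    mul_le_mul_of_nonneg_right (div_le_div_of_nonneg_right (inv_RN_sq_le hN hR) (by norm_num)) hx4
  have e : ((N : ℝ)⁻¹) ^ 2 / 12 * x ^ 4 = x ^ 4 / (12 * (N : ℝ) ^ 2) := by
    field_simp
  rw [← e]
  exact abs_sub_le_iff.mpr ⟨by linarith, by linarith⟩

/-- **King's (4.31)**, the zone-UNIFORM rate of the inverse symbol: `|Δ^{(N)}(q)⁻¹ − Δ^{(RN)}(q)⁻¹| ≤ (π²/24)N⁻²`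
for `|q_ν| ≤ πN`, `q ≠ 0` — also at the zone centre `q = p′` (where the relative rate `inv_DeltaXir_sub_le`
of the sibling carries `|p′|⁻²`).  From `King1986.latticeSymbol_inv_sub_ref_le` at both levels.
[cite: King1986, (4.31) p.673] [folklore] -/
theorem inv_DeltaXir_sub_abs (hN : 1 ≤ N) (hR : 1 ≤ R) {q : Fin d → ℝ} (hq : ∀ ν, |q ν| ≤ Real.pi * N)
    (hq0 : 0 < momSq q) :
    |(DeltaXir N 0 q)⁻¹ - (DeltaXir (R * N) 0 q)⁻¹| ≤ Real.pi ^ 2 / 24 * ((N : ℝ) ^ 2)⁻¹ := by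
  have hN0 : N ≠ 0 := by omega
  have hRN0 : R * N ≠ 0 := Nat.mul_ne_zero (by omega) hN0
  have hN' : (0 : ℝ) < N := by exact_mod_cast Nat.pos_of_ne_zero hN0
  have hRN' : (0 : ℝ) < ((R * N : ℕ) : ℝ) := by exact_mod_cast Nat.pos_of_ne_zero hRN0
  rw [King1986.DeltaXir_eq_latticeSymbol hN0, King1986.DeltaXir_eq_latticeSymbol hRN0]
  have h1 := King1986.latticeSymbol_inv_sub_ref_le (M := 0) (inv_ne_zero hN'.ne') le_rfl
    (p := q) (fun ν => zone_eta hN (hq ν)) hq0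
  have h2 := King1986.latticeSymbol_inv_sub_ref_le (M := 0) (inv_ne_zero hRN'.ne') le_rfl
    (p := q) (fun ν => zone_eta (one_le_RN hN hR) (zone_RN hR (hq ν))) hq0
  have hπ := Real.pi_pos
  calc |(King1986.latticeSymbol ((N : ℝ)⁻¹) 0 q)⁻¹ - (King1986.latticeSymbol (((R * N : ℕ) : ℝ)⁻¹) 0 q)⁻¹|
      ≤ |(King1986.latticeSymbol ((N : ℝ)⁻¹) 0 q)⁻¹ - (momSq q + 0)⁻¹|
          + |(momSq q + 0)⁻¹ - (King1986.latticeSymbol (((R * N : ℕ) : ℝ)⁻¹) 0 q)⁻¹| := abs_sub_le _ _ _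
    _ = |(King1986.latticeSymbol ((N : ℝ)⁻¹) 0 q)⁻¹ - (momSq q + 0)⁻¹|
          + |(King1986.latticeSymbol (((R * N : ℕ) : ℝ)⁻¹) 0 q)⁻¹ - (momSq q + 0)⁻¹| := by
        rw [abs_sub_comm ((momSq q + 0)⁻¹)]
    _ ≤ Real.pi ^ 2 / 48 * ((N : ℝ)⁻¹) ^ 2 + Real.pi ^ 2 / 48 * (((R * N : ℕ) : ℝ)⁻¹) ^ 2 :=
        add_le_add h1 h2
    _ ≤ Real.pi ^ 2 / 48 * ((N : ℝ)⁻¹) ^ 2 + Real.pi ^ 2 / 48 * ((N : ℝ)⁻¹) ^ 2 := by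
        gcongr ?_ + Real.pi ^ 2 / 48 * ?_
        · exact le_rfl
        · exact inv_RN_sq_le hN hR
    _ = Real.pi ^ 2 / 24 * ((N : ℝ) ^ 2)⁻¹ := by rw [inv_pow]; ring

/-- `(4/π²)x² ≤ S^{(n)}(x)` on the zone `|x| ≤ πn`. [folklore] -/
theorem Sxir_ge_jordan {n : ℕ} (hn : 1 ≤ n) {x : ℝ} (hx : |x| ≤ Real.pi * n) :
    4 / Real.pi ^ 2 * x ^ 2 ≤ Sxir n x := by
  have hn0 : n ≠ 0 := by omega
  have hn' : (0 : ℝ) < n := by exact_mod_cast Nat.pos_of_ne_zero hn0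
  rw [King1986.Sxir_eq_fdSymbol hn0]
  exact King1986.fdSymbol_ge_jordan (inv_ne_zero hn'.ne') (zone_eta hn hx)

/-- the ZONE-CENTRE rate of one `u`-factor `|u-factor(p′_μ)|² = S₁(x)/S^{(n)}(x)` (`x = p′_μ`, `|x| ≤ π`,
offset `l_μ = 0`): `|·^{(N)} − ·^{(RN)}| ≤ (π⁴/192)·x²·N⁻²` — SECOND order, from §1's quartic lemma and the
Jordan bound (King's (4.25)/(4.29) are first order `C|p′+l|L⁻ᵏ`; at `l = 0` one more order is available and
is what makes the (1.87)/(1.88) zone-centre terms rate-bounded). [folklore] -/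
theorem uFactorr_zero_rate (hN : 1 ≤ N) (hR : 1 ≤ R) {x : ℝ} (hx : |x| ≤ Real.pi) :
    |uFactorr N 0 x - uFactorr (R * N) 0 x| ≤ Real.pi ^ 4 / 192 * x ^ 2 * ((N : ℝ) ^ 2)⁻¹ := by
  have hRN := one_le_RN hN hR
  have hN' : (0 : ℝ) < N := by exact_mod_cast hN
  have hπ := Real.pi_pos
  rcases eq_or_ne x 0 with hx0 | hx0
  · subst hx0; simp [uFactorr]
  have hxN : |x| ≤ Real.pi * N := by
    have : (1 : ℝ) ≤ N := by exact_mod_cast hN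
    nlinarith [abs_nonneg x]
  have hxRN : |x| ≤ Real.pi * (R * N : ℕ) := zone_RN hR hxN
  have hSN : 0 < Sxir N x := Sxir_pos N hN x hx0 (by nlinarith [abs_nonneg x, (show (1:ℝ) ≤ N by exact_mod_cast hN)] )
  have hSRN : 0 < Sxir (R * N) x := Sxir_pos (R * N) hRN x hx0
    (by nlinarith [abs_nonneg x, (show (1:ℝ) ≤ (R * N : ℕ) by exact_mod_cast hRN)])
  have jN := Sxir_ge_jordan hN hxN
  have jRN := Sxir_ge_jordan hRN hxRN
  have hq := Sxir_sub_le_quartic hN hR hxN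
  have hS1 := Beta.SymbolExpansion.S1r_le_sq x
  have hS1' := S1r_nonneg x
  have hx2 : 0 < x ^ 2 := by positivity
  unfold uFactorr
  simp only [if_true, hx0, if_false]
  rw [div_sub_div _ _ hSN.ne' hSRN.ne', abs_div, abs_of_pos (mul_pos hSN hSRN),
    div_le_iff₀ (mul_pos hSN hSRN)]
  have e1 : S1r x * Sxir (R * N) x - Sxir N x * S1r x = S1r x * (Sxir (R * N) x - Sxir N x) := by ring
  rw [e1, abs_mul, abs_of_nonneg hS1', abs_sub_comm]
  -- `S₁·|ΔS| ≤ x²·x⁴/(12N²)` and `(4/π²)²x⁴ ≤ S_N S_RN`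
  have hprod : (4 / Real.pi ^ 2 * x ^ 2) * (4 / Real.pi ^ 2 * x ^ 2) ≤ Sxir N x * Sxir (R * N) x :=
    mul_le_mul jN jRN (by positivity) hSN.le
  calc S1r x * |Sxir N x - Sxir (R * N) x| ≤ x ^ 2 * (x ^ 4 / (12 * (N : ℝ) ^ 2)) :=
        mul_le_mul hS1 hq (abs_nonneg _) (by positivity)
    _ = Real.pi ^ 4 / 192 * x ^ 2 * ((N : ℝ) ^ 2)⁻¹ * ((4 / Real.pi ^ 2 * x ^ 2) * (4 / Real.pi ^ 2 * x ^ 2)) := by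
        field_simp; ring
    _ ≤ Real.pi ^ 4 / 192 * x ^ 2 * ((N : ℝ) ^ 2)⁻¹ * (Sxir N x * Sxir (R * N) x) := by
        gcongr

/-- real products with factors in `[0,1]`: `|Π f − Π g| ≤ Σ|f − g|`. [folklore] -/
theorem abs_prod_sub_prod_le {ι : Type*} [DecidableEq ι] (t : Finset ι) (f g : ι → ℝ)
    (hf0 : ∀ i ∈ t, 0 ≤ f i) (hf1 : ∀ i ∈ t, f i ≤ 1) (hg0 : ∀ i ∈ t, 0 ≤ g i) (hg1 : ∀ i ∈ t, g i ≤ 1) :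
    |∏ i ∈ t, f i - ∏ i ∈ t, g i| ≤ ∑ i ∈ t, |f i - g i| := by
  induction t using Finset.induction_on with
  | empty => simp
  | @insert j t hj ih =>
    have hf0' : ∀ i ∈ t, 0 ≤ f i := fun i hi => hf0 i (mem_insert_of_mem hi)
    have hf1' : ∀ i ∈ t, f i ≤ 1 := fun i hi => hf1 i (mem_insert_of_mem hi)
    have hg0' : ∀ i ∈ t, 0 ≤ g i := fun i hi => hg0 i (mem_insert_of_mem hi)
    have hg1' : ∀ i ∈ t, g i ≤ 1 := fun i hi => hg1 i (mem_insert_of_mem hi)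
    have ih' := ih hf0' hf1' hg0' hg1'
    rw [prod_insert hj, prod_insert hj, sum_insert hj]
    have hPf : 0 ≤ ∏ i ∈ t, f i := prod_nonneg hf0'
    have hPf1 : ∏ i ∈ t, f i ≤ 1 := prod_le_one hf0' hf1'
    have hPg : 0 ≤ ∏ i ∈ t, g i := prod_nonneg hg0'
    have hPg1 : ∏ i ∈ t, g i ≤ 1 := prod_le_one hg0' hg1'
    have hgj0 := hg0 j (mem_insert_self j t)
    have hgj1 := hg1 j (mem_insert_self j t)
    have e : f j * ∏ i ∈ t, f i - g j * ∏ i ∈ t, g i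
        = (f j - g j) * ∏ i ∈ t, f i + g j * (∏ i ∈ t, f i - ∏ i ∈ t, g i) := by ring
    rw [e]
    refine (abs_add_le _ _).trans ?_
    rw [abs_mul, abs_mul, abs_of_nonneg hPf, abs_of_nonneg hgj0]
    have h1 : |f j - g j| * ∏ i ∈ t, f i ≤ |f j - g j| := by
      have := abs_nonneg (f j - g j); nlinarith
    have h2 : g j * |∏ i ∈ t, f i - ∏ i ∈ t, g i| ≤ ∑ i ∈ t, |f i - g i| := by
      have := abs_nonneg (∏ i ∈ t, f i - ∏ i ∈ t, g i)
      have hs : 0 ≤ ∑ i ∈ t, |f i - g i| := sum_nonneg fun i _ => abs_nonneg _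
      nlinarith
    linarith

/-- the ZONE-CENTRE rate of `|u(p′)|²`: `||u(p′)|²_{(N)} − |u(p′)|²_{(RN)}| ≤ (π⁴/192)|p′|²N⁻²` on the
Brillouin zone. [folklore] -/
theorem Ur_zero_rate [NeZero N] [NeZero R] (hN : 1 ≤ N) (hR : 1 ≤ R) {s : Fin d → ℝ}
    (hs : ∀ ν, |s ν| ≤ Real.pi) :
    haveI : NeZero (R * N) := ⟨Nat.mul_ne_zero (NeZero.ne R) (NeZero.ne N)⟩
    |Ur N (fun _ => 0) s - Ur (R * N) (fun _ => 0) s| ≤ Real.pi ^ 4 / 192 * momSq s * ((N : ℝ) ^ 2)⁻¹ := by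
  haveI : NeZero (R * N) := ⟨Nat.mul_ne_zero (NeZero.ne R) (NeZero.ne N)⟩
  have hRN := one_le_RN hN hR
  unfold Ur
  simp only [Fin.val_zero]
  refine (abs_prod_sub_prod_le _ _ _ (fun ν _ => uFactorr_nonneg _ _ _)
    (fun ν _ => uFactorr_le_one N hN 0 (s ν)) (fun ν _ => uFactorr_nonneg _ _ _)
    (fun ν _ => uFactorr_le_one (R * N) hRN 0 (s ν))).trans ?_
  unfold King1986.momSq
  rw [Finset.mul_sum, Finset.sum_mul]
  exact Finset.sum_le_sum fun ν _ => (uFactorr_zero_rate hN hR (hs ν)).trans (le_of_eq (by ring))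

end Centre

/-! ## §2 The printed sub-expressions of (1.83) in physical variables -/

section Objects

variable (n : ℕ) [NeZero n]

/-- the vector of the SECOND term of (1.83): `x_μ(l) = conj[u(p′+l)v_μ(p′+l)]/Δ(p′+l)` in King's variables,
`= ū_η(q)·f_η(q_μ)·Δ^η(q)⁻¹` (`q` a representative of `p′+l`; bridges of `B5Hk163Rate`).
[cite: Balaban1984PropagatorsI, (1.83) p.31 (second term)] [folklore] -/
def xP (μ : Fin d) (q : Fin d → ℝ) : ℂ :=
  uWeight ((n : ℝ)⁻¹) q * uFac ((n : ℝ)⁻¹) (q μ) * (((DeltaXir n 0 q : ℝ) : ℂ))⁻¹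

/-- the coefficient `a·φ_μ(p′)⁻¹` of the second term of (1.83) (`φ_μ` = (1.84) = `B5Prop11Leaves.phiMu`).
[cite: Balaban1984PropagatorsI, (1.83)–(1.84) p.31] [folklore] -/
def cX (a : ℝ) (μ : Fin d) (s : Fin d → ℝ) : ℝ := a / phiMu n a μ s

/-- the FIRST SQUARE BRACKET `b(l, μ)` of (1.83) in King's variables:
`conj D_η(q_μ)·ū_η(q)·Δ^η(q)⁻²·ψ₂(p′)⁻¹ − aφ_μ⁻¹·ū_η(q) f_η(q_μ)·∂_{1,μ}(p′)·Δ^η(q)⁻¹`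
(`ψ₂ = Σ_{l″}|u|²/Δ²` = `B5ActionRate166.psiSum`). [cite: Balaban1984PropagatorsI, (1.83) p.31 (third term)] [folklore] -/
def bP (a : ℝ) (μ : Fin d) (q s : Fin d → ℝ) : ℂ :=
  conj (fdq ((n : ℝ)⁻¹) (q μ)) * uWeight ((n : ℝ)⁻¹) q * (((DeltaXir n 0 q : ℝ) : ℂ))⁻¹
      * (((DeltaXir n 0 q : ℝ) : ℂ))⁻¹ * (((psiSum n s : ℝ) : ℂ))⁻¹
    - ((cX n a μ s : ℝ) : ℂ) * uWeight ((n : ℝ)⁻¹) q * uFac ((n : ℝ)⁻¹) (q μ) * d1Sym s μ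
      * (((DeltaXir n 0 q : ℝ) : ℂ))⁻¹

/-- the REGULARISED bracket `b(l,μ)/Δ₀(p′)` (the printed «additional factor Δ₀(p′)» of p. 32 moved onto
the bracket). [cite: Balaban1984PropagatorsI, (1.88) p.32 (text below)] [folklore] -/
def bR (a : ℝ) (μ : Fin d) (q s : Fin d → ℝ) : ℂ := bP n a μ q s * (((Delta1r 0 s : ℝ) : ℂ))⁻¹

/-- the REGULARISED rank-one coefficient `Δ₀(p′)²·a⁻¹·(Σ_λ|∂_{1,λ}(p′)|²/φ_λ(p′))⁻¹ = (a·q₁₈₆(p′))⁻¹`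
(«This factor multiplying the function between the square bracket expressions gives an inverse of the
expression (1.86)», p. 32; `Σ_λ|∂_{1,λ}|²/φ_λ` = `B5QGQ199Rate.sigma199`).
[cite: Balaban1984PropagatorsI, (1.86) p.32] [folklore] -/
def cB (a : ℝ) (s : Fin d → ℝ) : ℝ := Delta1r 0 s ^ 2 / (a * sigma199 n a s)

/-- the `l″ = 0` term of (1.84)'s sum: `|u(p′)|²|v_μ(p′)|²/Δ(p′)`. [folklore] -/
def T0 (μ : Fin d) (s : Fin d → ℝ) : ℝ :=
  Ur n (fun _ => 0) s * uFactorr n 0 (s μ) / DeltaXir n 0 s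

/-- the PUNCTURED sum `S₁(μ) = Σ_{l″ ≠ 0}|u(p′+l″)v_μ(p′+l″)|²/Δ(p′+l″)` of (1.87).
[cite: Balaban1984PropagatorsI, (1.87) p.32] [folklore] -/
def S1x (μ : Fin d) (s : Fin d → ℝ) : ℝ :=
  ∑ k ∈ univ.erase (fun _ => (0 : Fin n)), Ur n k s * uFactorr n (k μ : ℕ) (s μ) / DeltaXir n 0 (shiftr n k s)

/-- the PUNCTURED sum `S₂ = Σ_{l″ ≠ 0}|u(p′+l″)|²/Δ²(p′+l″)` of (1.88).
[cite: Balaban1984PropagatorsI, (1.88) p.32] [folklore] -/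
def S2x (s : Fin d → ℝ) : ℝ :=
  ∑ k ∈ univ.erase (fun _ => (0 : Fin n)), Ur n k s / DeltaXir n 0 (shiftr n k s) ^ 2

/-- the CURLY BRACKET of (1.88) at `l = 0` divided by `Δ₀²`, after the cancellation of `l″ = l`:
`1 + aS₁(μ) − a|v_μ(p′)|²Δ(p′)S₂` (= `B5Prop11Bound`'s `Fiber.Br`). [cite: Balaban1984PropagatorsI, (1.88) p.32] [folklore] -/
def BrP (a : ℝ) (μ : Fin d) (s : Fin d → ℝ) : ℝ :=
  1 + a * S1x n μ s - a * uFactorr n 0 (s μ) * DeltaXir n 0 s * S2x n s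

/-- the COMBINED zone-centre diagonal of (1.87): `(1 + aS₁(μ))/(φ_μ(p′)Δ(p′))` — the `l = l′ = 0`,
`μ = ν` entry of the first two terms of (1.83) after «the cancellation of the terms with `l′ = l`».
[cite: Balaban1984PropagatorsI, (1.87) p.32] [folklore] -/
def dZ (a : ℝ) (μ : Fin d) (s : Fin d → ℝ) : ℝ := (1 + a * S1x n μ s) / (phiMu n a μ s * DeltaXir n 0 s)

/-- the real scalar of the zone-centre bracket: `rS = (Δ₀/Δ(p′))²·ψ₂(p′)⁻¹·(Δ₀φ_μ)⁻¹·BrP`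
(`ψ₂ = Δ₀²Σ|u|²/Δ²` = `T4GaugeActionRate.psi163`), so that `bR(p′) = conj D(p′_μ)·ū(p′)·rS` (§3).
[cite: Balaban1984PropagatorsI, (1.88) p.32] [folklore] -/
def rS (a : ℝ) (μ : Fin d) (s : Fin d → ℝ) : ℝ :=
  (Delta1r 0 s / DeltaXir n 0 s) ^ 2 * (T4GaugeActionRate.psi163 n s)⁻¹
    * (Delta1r 0 s * phiMu n a μ s)⁻¹ * BrP n a μ s

variable {n}

/-- (1.84) split at `l″ = 0`: `φ_μ = 1 + a(T₀ + S₁)`. [folklore] -/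
theorem phiMu_eq_T0_S1x (a : ℝ) (μ : Fin d) (s : Fin d → ℝ) :
    phiMu n a μ s = 1 + a * (T0 n μ s + S1x n μ s) := by
  unfold phiMu T0 S1x
  rw [← Finset.add_sum_erase _ _ (Finset.mem_univ (fun _ => (0 : Fin n)))]
  simp only [Fin.val_zero, shiftr_zero]

/-- `ψ₂ = |u(p′)|²/Δ(p′)² + S₂`. [folklore] -/
theorem psiSum_eq_S2x (s : Fin d → ℝ) :
    psiSum n s = Ur n (fun _ => 0) s / DeltaXir n 0 s ^ 2 + S2x n s := by
  unfold B5ActionRate166.psiSum S2x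
  rw [← Finset.add_sum_erase _ _ (Finset.mem_univ (fun _ => (0 : Fin n)))]
  simp only [shiftr_zero]

/-- `S₁(μ) ≥ 0`. [folklore] -/
theorem S1x_nonneg (μ : Fin d) (s : Fin d → ℝ) : 0 ≤ S1x n μ s :=
  Finset.sum_nonneg fun k _ => phiMu_term_nonneg n μ s k

/-- `S₂ ≥ 0`. [folklore] -/
theorem S2x_nonneg (s : Fin d → ℝ) : 0 ≤ S2x n s :=
  Finset.sum_nonneg fun _ _ => div_nonneg (Ur_nonneg _ _ _) (sq_nonneg _)

/-- `S₁(μ) ≤ ¼Σ_{l″≠0}|u|² ≤ ¼` (`Δ(p′+l″) ≥ 4`, `|v_μ| ≤ 1`, `S₀ ≤ 1`). [folklore] -/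
theorem S1x_le (hn : 1 ≤ n) (μ : Fin d) (s : Fin d → ℝ) (hs : ∀ ν, |s ν| ≤ Real.pi) :
    S1x n μ s ≤ 1 / 4 := by
  have h0 := S0_le_one n hn s hs
  unfold S1x
  have hterm : ∀ k ∈ univ.erase (fun _ => (0 : Fin n)),
      Ur n k s * uFactorr n (k μ : ℕ) (s μ) / DeltaXir n 0 (shiftr n k s) ≤ Ur n k s / 4 := by
    intro k hk
    have hk0 : k ≠ fun _ => 0 := (Finset.mem_erase.mp hk).1
    have h4 := DeltaXir_shift_ge_four n k hk0 s hs
    have hU := Ur_nonneg n k s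
    have hv0 := uFactorr_nonneg n (k μ : ℕ) (s μ)
    have hv1 := uFactorr_le_one n hn (k μ : ℕ) (s μ)
    rw [div_le_div_iff₀ (by linarith) (by norm_num)]
    nlinarith [mul_nonneg hU hv0]
  calc ∑ k ∈ univ.erase (fun _ => (0 : Fin n)), Ur n k s * uFactorr n (k μ : ℕ) (s μ) / DeltaXir n 0 (shiftr n k s)
      ≤ ∑ k ∈ univ.erase (fun _ => (0 : Fin n)), Ur n k s / 4 := Finset.sum_le_sum hterm
    _ = (∑ k ∈ univ.erase (fun _ => (0 : Fin n)), Ur n k s) / 4 := by rw [Finset.sum_div]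
    _ ≤ 1 / 4 := by linarith

/-- `S₂ ≤ Σ_{l″≠0}|u|²/16 ≤ 1/16`. [folklore] -/
theorem S2x_le (hn : 1 ≤ n) (s : Fin d → ℝ) (hs : ∀ ν, |s ν| ≤ Real.pi) : S2x n s ≤ 1 / 16 := by
  have h0 := S0_le_one n hn s hs
  unfold S2x
  have hterm : ∀ k ∈ univ.erase (fun _ => (0 : Fin n)),
      Ur n k s / DeltaXir n 0 (shiftr n k s) ^ 2 ≤ Ur n k s / 16 := by
    intro k hk
    have hk0 : k ≠ fun _ => 0 := (Finset.mem_erase.mp hk).1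
    have h4 := DeltaXir_shift_ge_four n k hk0 s hs
    have h16 : (16 : ℝ) ≤ DeltaXir n 0 (shiftr n k s) ^ 2 := by nlinarith
    exact div_le_div_of_nonneg_left (Ur_nonneg n k s) (by norm_num) h16
  calc ∑ k ∈ univ.erase (fun _ => (0 : Fin n)), Ur n k s / DeltaXir n 0 (shiftr n k s) ^ 2
      ≤ ∑ k ∈ univ.erase (fun _ => (0 : Fin n)), Ur n k s / 16 := Finset.sum_le_sum hterm
    _ = (∑ k ∈ univ.erase (fun _ => (0 : Fin n)), Ur n k s) / 16 := by rw [Finset.sum_div]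
    _ ≤ 1 / 16 := by linarith

end Objects

/-! ## §3 Identification with the typed fibre matrix `B5Prop11Bound.Fiber.G` of `B5Prop11Fiber.balabanFiber` -/

section Bridge

variable {n : ℕ} [NeZero n]

/-- `IsRep` of the zero offset: `p′` itself represents `p′ + 0`. [folklore] -/
theorem isRep_zero (hn : 1 ≤ n) {s : Fin d → ℝ} (hs : ∀ ν, |s ν| ≤ Real.pi) :
    IsRep n (fun _ => (0 : Fin n)) s s := by
  refine ⟨fun ν => ⟨0, ?_⟩, fun ν => ?_⟩
  · rw [shiftr_zero]; simp
  · have : (1 : ℝ) ≤ n := by exact_mod_cast hn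
    nlinarith [hs ν, abs_nonneg (s ν), Real.pi_pos]

/-- helper: `‖u(p′+l)v_μ(p′+l)‖² = Ur·uFactorr`. [folklore] -/
theorem norm_uSym_vSym_sq (hn : 1 ≤ n) {s : Fin d → ℝ} (hs : ∀ ν, |s ν| ≤ Real.pi) (k : Fin d → Fin n)
    (μ : Fin d) : ‖uSym n k s * vSym n k s μ‖ ^ 2 = Ur n k s * uFactorr n (k μ : ℕ) (s μ) := by
  rw [norm_mul, mul_pow, norm_uSym_sq n hn k s hs, norm_vSym_sq n hn k s μ (hs μ)]

omit [NeZero n] in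
/-- `Δ₀(p′) ≠ 0` on the punctured zone. [folklore] -/
theorem Delta1r_ne_zero {s : Fin d → ℝ} (hs : ∀ ν, |s ν| ≤ Real.pi) (hs0 : s ≠ 0) : Delta1r 0 s ≠ 0 := by
  obtain ⟨ν₀, hν₀⟩ : ∃ ν, s ν ≠ 0 := Function.ne_iff.mp hs0
  exact (Delta1r_pos s hs ν₀ hν₀).ne'

variable (hn : 1 ≤ n) (a : ℝ) (ha : 0 < a) (s : Fin d → ℝ) (hs : ∀ ν, |s ν| ≤ Real.pi) (hs0 : s ≠ 0)

local notation "F" => balabanFiber n hn a ha s hs hs0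

/-- `X = ψ₂(p′)` (`Fiber.X` of Bałaban's fibre is `psiSum`). [folklore] -/
theorem fiber_X_eq : (F).X = psiSum n s := by
  unfold Fiber.X B5ActionRate166.psiSum
  refine Finset.sum_congr rfl fun k _ => ?_
  show ‖uSym n k s‖ ^ 2 / DeltaXir n 0 (shiftr n k s) ^ 2 = _
  rw [norm_uSym_sq n hn k s hs]

/-- `φ_μ` of the fibre is (1.84) = `phiMu`. [folklore] -/
theorem fiber_φ_eq (μ : Fin d) : (F).φ μ = phiMu n a μ s := by
  unfold Fiber.φ phiMu
  show 1 + a * ∑ k, ‖uSym n k s * vSym n k s μ‖ ^ 2 / DeltaXir n 0 (shiftr n k s) = _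
  simp_rw [norm_uSym_vSym_sq hn hs]

/-- `Φ = Σ_λ|∂_{1,λ}|²/φ_λ` of the fibre is `sigma199`. [folklore] -/
theorem fiber_Φ_eq : (F).Φ = sigma199 n a s := by
  unfold Fiber.Φ B5QGQ199Rate.sigma199
  refine Finset.sum_congr rfl fun μ _ => ?_
  rw [fiber_φ_eq hn a ha s hs hs0 μ]
  show ‖d1Sym s μ‖ ^ 2 / phiMu n a μ s = _
  rw [norm_d1Sym_sq]

/-- `S₁(μ)` of the fibre is `S1x`. [folklore] -/
theorem fiber_S₁_eq (μ : Fin d) : (F).S₁ μ = S1x n μ s := by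
  unfold Fiber.S₁ S1x
  refine Finset.sum_congr rfl fun k _ => ?_
  show ‖uSym n k s * vSym n k s μ‖ ^ 2 / DeltaXir n 0 (shiftr n k s) = _
  rw [norm_uSym_vSym_sq hn hs k μ]

/-- `S₂` of the fibre is `S2x`. [folklore] -/
theorem fiber_S₂_eq : (F).S₂ = S2x n s := by
  unfold Fiber.S₂ S2x
  refine Finset.sum_congr rfl fun k _ => ?_
  show ‖uSym n k s‖ ^ 2 / DeltaXir n 0 (shiftr n k s) ^ 2 = _
  rw [norm_uSym_sq n hn k s hs]

/-- `Δ(p′ + 0) = Δ^{(n)}(p′)`. [folklore] -/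
theorem fiber_Δo_eq : (F).Δ (F).o = DeltaXir n 0 s := by
  show DeltaXir n 0 (shiftr n (fun _ => 0) s) = _
  rw [shiftr_zero]

/-- `Br_μ` of the fibre (`B5Prop11Bound`'s curly bracket of (1.88)) is `BrP`. [folklore] -/
theorem fiber_Br_eq (μ : Fin d) : (F).Br μ = BrP n a μ s := by
  have hv : ‖(F).v μ (F).o‖ ^ 2 = uFactorr n 0 (s μ) := by
    show ‖vSym n (fun _ => 0) s μ‖ ^ 2 = _
    rw [norm_vSym_sq n hn _ s μ (hs μ), Fin.val_zero]
  unfold Fiber.Br BrP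
  rw [fiber_S₁_eq, fiber_S₂_eq, fiber_Δo_eq, hv]
  rfl

/-- `x_μ(l)` of the fibre at a representative is `xP(q)` (bridges 1, 3, 4 of the sibling). [folklore] -/
theorem fiber_x_eq {k : Fin d → Fin n} {q : Fin d → ℝ} (hk : IsRep n k s q) (μ : Fin d) :
    (F).x μ k = xP n μ q := by
  unfold Fiber.x xP
  show conj (uSym n k s * vSym n k s μ) / ((DeltaXir n 0 (shiftr n k s) : ℝ) : ℂ) = _
  rw [map_mul, hk.conj_uSym_eq hn hs, hk.conj_vSym_eq hn hs μ, hk.DeltaXir_eq hn, div_eq_mul_inv]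

/-- the coefficient of the fibre's second term is `cX`. [folklore] -/
theorem fiber_coef_eq (μ : Fin d) :
    ((F).a : ℂ) / ((F).φ μ : ℂ) = ((cX n a μ s : ℝ) : ℂ) := by
  rw [fiber_φ_eq]
  show ((a : ℝ) : ℂ) / ((phiMu n a μ s : ℝ) : ℂ) = _
  unfold cX
  push_cast
  rfl

/-- `b(l, μ)` of the fibre at a representative is `bP(q)`. [folklore] -/
theorem fiber_b_eq {k : Fin d → Fin n} {q : Fin d → ℝ} (hk : IsRep n k s q) (μ : Fin d) :
    (F).b k μ = bP n a μ q s := by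
  have e1 : (F).e μ k = conj (fdq ((n : ℝ)⁻¹) (q μ)) := hk.dSym_eq hn μ
  have e2 : conj ((F).u k) = uWeight ((n : ℝ)⁻¹) q := hk.conj_uSym_eq hn hs
  have e3 : conj ((F).u k * (F).v μ k) = uWeight ((n : ℝ)⁻¹) q * uFac ((n : ℝ)⁻¹) (q μ) := by
    show conj (uSym n k s * vSym n k s μ) = _
    rw [map_mul, hk.conj_uSym_eq hn hs, hk.conj_vSym_eq hn hs μ]
  have e4 : (((F).Δ k : ℝ) : ℂ) = ((DeltaXir n 0 q : ℝ) : ℂ) := by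
    show ((DeltaXir n 0 (shiftr n k s) : ℝ) : ℂ) = _
    rw [hk.DeltaXir_eq hn]
  have e5 : (F).e₁ μ = d1Sym s μ := rfl
  have eA : ((F).a : ℂ) = ((a : ℝ) : ℂ) := rfl
  have eφ : (((F).φ μ : ℝ) : ℂ) = ((phiMu n a μ s : ℝ) : ℂ) := by rw [fiber_φ_eq]
  have eX : (((F).X : ℝ) : ℂ) = ((psiSum n s : ℝ) : ℂ) := by rw [fiber_X_eq]
  unfold Fiber.b bP cX
  rw [e1, e2, e3, e4, e5, eA, eφ, eX]
  push_cast
  ring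

/-- the scalar between the brackets: `cT = a⁻¹Φ⁻¹ = 1/(a·sigma199)`. [folklore] -/
theorem fiber_cT_eq : (F).cT = 1 / (((a : ℝ) : ℂ) * ((sigma199 n a s : ℝ) : ℂ)) := by
  unfold Fiber.cT
  rw [fiber_Φ_eq]
  rfl

/-- the rank-one term regularised: `cT·b(l,μ)·conj b(l′,ν) = cB·bR(q)·conj bR(q′)` (the «additional factor
`Δ₀²(p′)`» moved from the brackets to the coefficient). [cite: Balaban1984PropagatorsI, p.32 (text below (1.88))] [folklore] -/
theorem fiber_rankOne_eq {k k' : Fin d → Fin n} {q q' : Fin d → ℝ} (hk : IsRep n k s q)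
    (hk' : IsRep n k' s q') (μ ν : Fin d) :
    (F).cT * (F).b k μ * conj ((F).b k' ν)
      = ((cB n a s : ℝ) : ℂ) * bR n a μ q s * conj (bR n a ν q' s) := by
  have hΔ : ((Delta1r 0 s : ℝ) : ℂ) ≠ 0 := Complex.ofReal_ne_zero.mpr (Delta1r_ne_zero hs hs0)
  have hc : ((Delta1r 0 s : ℝ) : ℂ) ^ 2 * ((((Delta1r 0 s : ℝ) : ℂ))⁻¹ * (((Delta1r 0 s : ℝ) : ℂ))⁻¹) = 1 := by
    have h2 : ((Delta1r 0 s : ℝ) : ℂ) ^ 2 ≠ 0 := pow_ne_zero 2 hΔ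
    field_simp
  rw [fiber_cT_eq, fiber_b_eq hn a ha s hs hs0 hk, fiber_b_eq hn a ha s hs hs0 hk']
  unfold bR cB
  rw [map_mul, map_inv₀, Complex.conj_ofReal]
  push_cast
  linear_combination
    (-(1 / (((a : ℝ) : ℂ) * ((sigma199 n a s : ℝ) : ℂ))) * bP n a μ q s * conj (bP n a ν q' s)) * hc

/-- **THE ENTRIES OF (1.83) IN PHYSICAL VARIABLES**: for Bałaban's fibre at `p′ = s` and representatives
`q, q′` of `p′+l, p′+l′`,
`G_{(l,μ),(l′,ν)} = δ_{μν}[δ_{ll′}Δ^{(n)}(q)⁻¹ − cX_μ·xP_μ(q)·conj xP_μ(q′)] + cB·bR_μ(q)·conj bR_ν(q′)`.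
[cite: Balaban1984PropagatorsI, (1.83) p.31] [folklore] -/
theorem fiber_G_entry_eq {k k' : Fin d → Fin n} {q q' : Fin d → ℝ} (hk : IsRep n k s q)
    (hk' : IsRep n k' s q') (μ ν : Fin d) :
    (F).G (k, μ) (k', ν)
      = (if μ = ν then
            ((if k = k' then (((DeltaXir n 0 q : ℝ) : ℂ))⁻¹ else 0)
              - ((cX n a μ s : ℝ) : ℂ) * xP n μ q * conj (xP n μ q'))
          else 0)
        + ((cB n a s : ℝ) : ℂ) * bR n a μ q s * conj (bR n a ν q' s) := by
  have hR := fiber_rankOne_eq hn a ha s hs hs0 hk hk' μ ν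
  have hc := fiber_coef_eq hn a ha s hs hs0 μ
  have hx := fiber_x_eq hn a ha s hs hs0 hk μ
  have hx' := fiber_x_eq hn a ha s hs hs0 hk' μ
  have hΔ : (1 : ℂ) / (((F).Δ k : ℝ) : ℂ) = (((DeltaXir n 0 q : ℝ) : ℂ))⁻¹ := by
    show (1 : ℂ) / ((DeltaXir n 0 (shiftr n k s) : ℝ) : ℂ) = _
    rw [hk.DeltaXir_eq hn, one_div]
  show (if μ = ν then
            ((if k = k' then 1 / (((F).Δ k : ℝ) : ℂ) else 0)
              - ((F).a : ℂ) / ((F).φ μ : ℂ) * (F).x μ k * conj ((F).x μ k'))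
          else 0) + (F).cT * (F).b k μ * conj ((F).b k' ν) = _
  rw [hR, hc, hx, hx', hΔ]

include hn ha hs hs0 in
/-- **(1.87)**: the `l = l′ = 0`, `μ = ν` entry of the first two terms regrouped —
`Δ^{(n)}(p′)⁻¹ − cX_μ·xP_μ(p′)·conj xP_μ(p′) = dZ_μ(p′)` (`B5Prop11Bound`'s `Fiber.O00` transported).
[cite: Balaban1984PropagatorsI, (1.87) p.32] [folklore] -/
theorem diag_zero_eq (μ : Fin d) :
    (((DeltaXir n 0 s : ℝ) : ℂ))⁻¹ - ((cX n a μ s : ℝ) : ℂ) * xP n μ s * conj (xP n μ s)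
      = ((dZ n a μ s : ℝ) : ℂ) := by
  have h := (F).O00 μ
  have hx : (F).x μ (F).o = xP n μ s := fiber_x_eq hn a ha s hs hs0 (isRep_zero hn hs) μ
  have hc := fiber_coef_eq hn a ha s hs hs0 μ
  have hS : (((F).S₁ μ : ℝ) : ℂ) = ((S1x n μ s : ℝ) : ℂ) := by rw [fiber_S₁_eq]
  have hΔ : (((F).Δ (F).o : ℝ) : ℂ) = ((DeltaXir n 0 s : ℝ) : ℂ) := by rw [fiber_Δo_eq]
  have hφ : (((F).φ μ : ℝ) : ℂ) = ((phiMu n a μ s : ℝ) : ℂ) := by rw [fiber_φ_eq]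
  have eA : ((F).a : ℂ) = ((a : ℝ) : ℂ) := rfl
  rw [hx, hc, hS, hΔ, eA, hφ, one_div, ← mul_assoc] at h
  rw [h]
  unfold dZ
  simp only [Complex.ofReal_div, Complex.ofReal_add, Complex.ofReal_one, Complex.ofReal_mul]

include hn ha hs hs0 in
/-- **(1.88) at `l = 0`**: `bR_μ(p′) = conj D(p′_μ)·ū(p′)·rS_μ(p′)` (`B5Prop11Bound`'s `Fiber.b_o_eq`, `Fiber.r_eq`
transported; `ψ₂ = Δ₀²·psiSum` by `B5ActionRate166.psi163_eq`).
[cite: Balaban1984PropagatorsI, (1.88) p.32] [folklore] -/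
theorem bR_zero_eq (μ : Fin d) :
    bR n a μ s s = conj (fdq ((n : ℝ)⁻¹) (s μ)) * uWeight ((n : ℝ)⁻¹) s * ((rS n a μ s : ℝ) : ℂ) := by
  obtain ⟨ν₀, hν₀⟩ : ∃ ν, s ν ≠ 0 := Function.ne_iff.mp hs0
  have hΔ0 : ((Delta1r 0 s : ℝ) : ℂ) ≠ 0 := Complex.ofReal_ne_zero.mpr (Delta1r_ne_zero hs hs0)
  have hD : ((DeltaXir n 0 s : ℝ) : ℂ) ≠ 0 :=
    Complex.ofReal_ne_zero.mpr (DeltaXir_pos n hn s hs ν₀ hν₀).ne'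
  have hψ : ((psiSum n s : ℝ) : ℂ) ≠ 0 := Complex.ofReal_ne_zero.mpr (psiSum_pos hn s hs ν₀ hν₀).ne'
  have hφ : ((phiMu n a μ s : ℝ) : ℂ) ≠ 0 :=
    Complex.ofReal_ne_zero.mpr (B5QGQ199Rate.phiMu_pos n a ha.le μ s).ne'
  have hb : (F).b (F).o μ = (F).e μ (F).o * conj ((F).u (F).o) * ((F).r μ : ℂ) := (F).b_o_eq μ
  have hb' : (F).b (F).o μ = bP n a μ s s := fiber_b_eq hn a ha s hs hs0 (isRep_zero hn hs) μ
  have e1 : (F).e μ (F).o = conj (fdq ((n : ℝ)⁻¹) (s μ)) := (isRep_zero hn hs).dSym_eq hn μ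
  have e2 : conj ((F).u (F).o) = uWeight ((n : ℝ)⁻¹) s := (isRep_zero hn hs).conj_uSym_eq hn hs
  rw [(F).r_eq μ, fiber_Br_eq, fiber_X_eq, fiber_φ_eq, fiber_Δo_eq, hb', e1, e2] at hb
  unfold bR
  rw [hb]
  unfold rS
  rw [B5ActionRate166.psi163_eq n hn s hs]
  push_cast
  field_simp

end Bridge

/-! ## §4 Majorants (King's (4.20)/(4.21) shape, explicit constants) -/

section Majorants

variable {n : ℕ} [NeZero n]

omit [NeZero n] in
/-- `|q_μ| ≤ |q|₁`. [folklore] -/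
theorem abs_le_sum_abs (q : Fin d → ℝ) (μ : Fin d) : |q μ| ≤ ∑ ν, |q ν| :=
  Finset.single_le_sum (f := fun ν => |q ν|) (fun _ _ => abs_nonneg _) (Finset.mem_univ μ)

omit [NeZero n] in
/-- `q_μ² ≤ |q|²`. [folklore] -/
theorem sq_le_momSq (q : Fin d → ℝ) (μ : Fin d) : q μ ^ 2 ≤ momSq q := by
  unfold King1986.momSq
  exact Finset.single_le_sum (f := fun ν => q ν ^ 2) (fun ν _ => sq_nonneg _) (Finset.mem_univ μ)

omit [NeZero n] in
/-- `|p′|² ≤ dπ²` on the Brillouin zone. [folklore] -/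
theorem momSq_le_zone {s : Fin d → ℝ} (hs : ∀ ν, |s ν| ≤ Real.pi) : momSq s ≤ d * Real.pi ^ 2 := by
  unfold King1986.momSq
  calc ∑ ν, s ν ^ 2 ≤ ∑ _ν : Fin d, Real.pi ^ 2 :=
        Finset.sum_le_sum fun ν _ => by rw [← sq_abs]; exact pow_le_pow_left₀ (abs_nonneg _) (hs ν) 2
    _ = d * Real.pi ^ 2 := by simp

omit [NeZero n] in
/-- `‖ū_{1/n}(q)‖ ≤ 1` on the fine zone. [folklore] -/
theorem norm_uWeight_le_one (hn : 1 ≤ n) {q : Fin d → ℝ} (hq : ∀ ν, |q ν| ≤ Real.pi * n) :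
    ‖uWeight ((n : ℝ)⁻¹) q‖ ≤ 1 := by
  rw [King1986.norm_uWeight]
  exact Finset.prod_le_one (fun _ _ => norm_nonneg _) fun ν _ => norm_uFac_le_one hn (hq ν)

omit [NeZero n] in
/-- `‖∂_{1,μ}(p′)‖ ≤ |p′_μ|`. [folklore] -/
theorem norm_d1Sym_le (s : Fin d → ℝ) (μ : Fin d) : ‖d1Sym s μ‖ ≤ |s μ| := by
  have h := norm_conj_d1Sym_le s μ
  rwa [Complex.norm_conj] at h

omit [NeZero n] in
/-- King's `|q|⁻²` factor `D(q) := (π²/4)|q|⁻²`, the majorant of `Δ^η(q)⁻¹` ((4.21)). [cite: King1986, (4.21) p.672] [folklore] -/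
def Dq (q : Fin d → ℝ) : ℝ := Real.pi ^ 2 / 4 / momSq q

omit [NeZero n] in
/-- King's (4.20) product `U(q) := Π_ν vMaj_ν(q)`, the majorant of `ū(q)`. [cite: King1986, (4.20) p.672] [folklore] -/
def Uq (s q : Fin d → ℝ) : ℝ := ∏ ν, vMaj s q ν

omit [NeZero n] in
/-- `D(q) ≥ 0`. [folklore] -/
theorem Dq_nonneg (q : Fin d → ℝ) : 0 ≤ Dq q := by
  unfold Dq; have := King1986.momSq_nonneg q; positivity

omit [NeZero n] in
/-- `U(q) ≥ 0`. [folklore] -/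
theorem Uq_nonneg (s q : Fin d → ℝ) : 0 ≤ Uq s q := Finset.prod_nonneg fun ν _ => vMaj_nonneg s q ν

omit [NeZero n] in
/-- the majorant of `xP_μ(q)`: `U(q)·vMaj_μ(q)·D(q)` (King: `C·Π_ν|p′_ν||q_ν|⁻¹·|p′_μ||q_μ|⁻¹·|q|⁻²` on aliased
coordinates). [cite: King1986, (4.20)–(4.21) p.672] [folklore] -/
def xMaj (s q : Fin d → ℝ) (μ : Fin d) : ℝ := Uq s q * vMaj s q μ * Dq q

omit [NeZero n] in
/-- `xMaj ≥ 0`. [folklore] -/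
theorem xMaj_nonneg (s q : Fin d → ℝ) (μ : Fin d) : 0 ≤ xMaj s q μ :=
  mul_nonneg (mul_nonneg (Uq_nonneg s q) (vMaj_nonneg s q μ)) (Dq_nonneg q)

omit [NeZero n] in
/-- **`‖xP_μ(q)‖ ≤ xMaj_μ(q)`** at every representative `q` of `p′ + l`. [folklore] -/
theorem norm_xP_le (hn : 1 ≤ n) {s q : Fin d → ℝ} (hs : ∀ ν, |s ν| ≤ Real.pi)
    (hq : ∀ ν, |q ν| ≤ Real.pi * n) (hq0 : 0 < momSq q) (hrep : ∀ ν, ∃ m : ℤ, q ν = s ν + 2 * Real.pi * m)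
    (μ : Fin d) : ‖xP n μ q‖ ≤ xMaj s q μ := by
  obtain ⟨m, hm⟩ := hrep μ
  unfold xP xMaj Uq Dq
  exact norm_mul_le_of_le (norm_mul_le_of_le (norm_uWeight_le_vMaj hn hs hq hrep)
    (norm_uFac_le_vMaj hn (hs μ) (hq μ) m hm)) (norm_inv_DeltaXir_le hn hq hq0)

/-- `cX > 0`. [folklore] -/
theorem cX_pos (a : ℝ) (ha : 0 < a) (μ : Fin d) (s : Fin d → ℝ) : 0 < cX n a μ s :=
  div_pos ha (B5QGQ199Rate.phiMu_pos n a ha.le μ s)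

/-- **`cX = aφ_μ⁻¹ ≤ Δ₀(p′)/γ₀`** (the printed «lim Δ₀φ_μ = a … bounded from below», (1.85), with the tree's
constant `γ₀ = (4/π²)^{d+2}` of `B5Prop11Leaves.ineq185_lower`). [cite: Balaban1984PropagatorsI, (1.85) p.32] [folklore] -/
theorem cX_le (hn : 1 ≤ n) (a : ℝ) (ha : 0 < a) (μ : Fin d) {s : Fin d → ℝ} (hs : ∀ ν, |s ν| ≤ Real.pi)
    (ν₀ : Fin d) (hν₀ : s ν₀ ≠ 0) : cX n a μ s ≤ Delta1r 0 s / T4GaugeActionRate.gam0 d := by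
  have h := ineq185_lower n hn a ha.le μ s hs ν₀ hν₀
  have hφ := B5QGQ199Rate.phiMu_pos n a ha.le μ s
  have hg := T4GaugeActionRate.gam0_pos d
  unfold cX
  rw [div_le_div_iff₀ hφ hg]
  unfold T4GaugeActionRate.gam0
  linarith

/-- `‖cX‖ ≤ Δ₀/γ₀` (complex cast). [folklore] -/
theorem norm_cX_le (hn : 1 ≤ n) (a : ℝ) (ha : 0 < a) (μ : Fin d) {s : Fin d → ℝ} (hs : ∀ ν, |s ν| ≤ Real.pi)
    (ν₀ : Fin d) (hν₀ : s ν₀ ≠ 0) :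
    ‖((cX n a μ s : ℝ) : ℂ)‖ ≤ Delta1r 0 s / T4GaugeActionRate.gam0 d := by
  rw [Complex.norm_real, Real.norm_eq_abs, abs_of_pos (cX_pos a ha μ s)]
  exact cX_le hn a ha μ hs ν₀ hν₀

/-- `q₁₈₆ > 0` on the punctured zone. [folklore] -/
theorem q186_pos (hn : 1 ≤ n) (a : ℝ) (ha : 0 < a) {s : Fin d → ℝ} (hs : ∀ ν, |s ν| ≤ Real.pi)
    (ν₀ : Fin d) (hν₀ : s ν₀ ≠ 0) : 0 < q186 n a s := by
  have hΔ := Delta1r_pos s hs ν₀ hν₀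
  exact lt_of_lt_of_le (by positivity) (B5QGQ199Rate.q186_eq_mean n hn a ha.le s hs ν₀ hν₀).2.1

/-- `cB = (a·q₁₈₆)⁻¹` («gives an inverse of the expression (1.86)», p.32). [cite: Balaban1984PropagatorsI, (1.86) p.32] [folklore] -/
theorem cB_eq (hn : 1 ≤ n) (a : ℝ) (ha : 0 < a) {s : Fin d → ℝ} (hs : ∀ ν, |s ν| ≤ Real.pi)
    (ν₀ : Fin d) (hν₀ : s ν₀ ≠ 0) : cB n a s = 1 / (a * q186 n a s) := by
  have hΔ := (Delta1r_pos s hs ν₀ hν₀).ne'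
  have hq := (q186_pos hn a ha hs ν₀ hν₀).ne'
  unfold cB
  rw [B5QGQ199Rate.sigma199_eq_q186 n a ha.le s hs ν₀ hν₀]
  field_simp

/-- `cB > 0`. [folklore] -/
theorem cB_pos (hn : 1 ≤ n) (a : ℝ) (ha : 0 < a) {s : Fin d → ℝ} (hs : ∀ ν, |s ν| ≤ Real.pi)
    (ν₀ : Fin d) (hν₀ : s ν₀ ≠ 0) : 0 < cB n a s := by
  rw [cB_eq hn a ha hs ν₀ hν₀]
  have := q186_pos hn a ha hs ν₀ hν₀
  positivity

/-- **`cB ≤ (Δ₀(p′) + a)/a ≤ (4d + a)/a`** (the box-mean lower bound `q₁₈₆ ≥ (Δ₀+a)⁻¹` of the sibling).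
[cite: Balaban1984PropagatorsI, (1.86) p.32] [folklore] -/
theorem cB_le (hn : 1 ≤ n) (a : ℝ) (ha : 0 < a) {s : Fin d → ℝ} (hs : ∀ ν, |s ν| ≤ Real.pi)
    (ν₀ : Fin d) (hν₀ : s ν₀ ≠ 0) :
    cB n a s ≤ (Delta1r 0 s + a) / a ∧ (Delta1r 0 s + a) / a ≤ (4 * d + a) / a := by
  have hΔ := Delta1r_pos s hs ν₀ hν₀
  have h4 := Delta1r_le s
  have hq := q186_pos hn a ha hs ν₀ hν₀
  have hD : 0 < Delta1r 0 s + a := by linarith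
  obtain ⟨_, h1, _⟩ := B5QGQ199Rate.q186_eq_mean n hn a ha.le s hs ν₀ hν₀
  rw [div_le_iff₀ hD] at h1
  refine ⟨?_, div_le_div_of_nonneg_right (by linarith) ha.le⟩
  rw [cB_eq hn a ha hs ν₀ hν₀, div_le_div_iff₀ (mul_pos ha hq) ha]
  nlinarith

/-- the majorant of the regularised bracket `bR_μ(q)` in the ALIASED form (all `q`; useful for `l ≠ 0`):
`U(q)D(q)γ₀⁻¹·(|q_μ|D(q)Δ₀(p′) + vMaj_μ(q)|p′_μ|)`. [folklore] -/
def bMajA (d : ℕ) (s q : Fin d → ℝ) (μ : Fin d) : ℝ :=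
  Uq s q * Dq q / T4GaugeActionRate.gam0 d * (|q μ| * Dq q * Delta1r 0 s + vMaj s q μ * |s μ|)

omit [NeZero n] in
/-- `bMajA ≥ 0`. [folklore] -/
theorem bMajA_nonneg (s q : Fin d → ℝ) (μ : Fin d) : 0 ≤ bMajA d s q μ := by
  unfold bMajA
  have := Uq_nonneg s q; have := Dq_nonneg q; have := vMaj_nonneg s q μ
  have := Delta1r_nonneg 0 le_rfl s; have := T4GaugeActionRate.gam0_pos d
  positivity

/-- **`‖bR_μ(q)‖ ≤ bMajA_μ(q)`** (termwise: `|D(q_μ)| ≤ |q_μ|`, (4.20), (4.21) twice, `ψ₂⁻¹ ≤ Δ₀²/γ₀`;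
`cX ≤ Δ₀/γ₀`, (4.20), `|∂_{1,μ}| ≤ |p′_μ|`, (4.21); then `·Δ₀⁻¹`). [folklore] -/
theorem norm_bR_le_alias (hn : 1 ≤ n) (a : ℝ) (ha : 0 < a) {s q : Fin d → ℝ} (hs : ∀ ν, |s ν| ≤ Real.pi)
    (ν₀ : Fin d) (hν₀ : s ν₀ ≠ 0) (hq : ∀ ν, |q ν| ≤ Real.pi * n)
    (hrep : ∀ ν, ∃ m : ℤ, q ν = s ν + 2 * Real.pi * m) (μ : Fin d) :
    ‖bR n a μ q s‖ ≤ bMajA d s q μ := by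
  have hq0 := momSq_pos_of_rep hs ν₀ hν₀ hrep
  obtain ⟨m, hm⟩ := hrep μ
  have hΔ := Delta1r_pos s hs ν₀ hν₀
  have hg := T4GaugeActionRate.gam0_pos d
  have hU : ‖uWeight ((n : ℝ)⁻¹) q‖ ≤ Uq s q := norm_uWeight_le_vMaj hn hs hq hrep
  have hV := norm_uFac_le_vMaj hn (hs μ) (hq μ) m hm
  have hD : ‖(((DeltaXir n 0 q : ℝ) : ℂ))⁻¹‖ ≤ Dq q := norm_inv_DeltaXir_le hn hq hq0
  have hF := norm_conj_fdq_le hn (q μ)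
  have hΨ := norm_inv_psiSum_le hn hs ν₀ hν₀
  have hC := norm_cX_le hn a ha μ hs ν₀ hν₀
  have hE := norm_d1Sym_le s μ
  have h1 : ‖conj (fdq ((n : ℝ)⁻¹) (q μ)) * uWeight ((n : ℝ)⁻¹) q * (((DeltaXir n 0 q : ℝ) : ℂ))⁻¹
        * (((DeltaXir n 0 q : ℝ) : ℂ))⁻¹ * (((psiSum n s : ℝ) : ℂ))⁻¹‖
      ≤ |q μ| * Uq s q * Dq q * Dq q * (Delta1r 0 s ^ 2 / T4GaugeActionRate.gam0 d) :=
    norm_mul_le_of_le (norm_mul_le_of_le (norm_mul_le_of_le (norm_mul_le_of_le hF hU) hD) hD) hΨ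
  have h2 : ‖((cX n a μ s : ℝ) : ℂ) * uWeight ((n : ℝ)⁻¹) q * uFac ((n : ℝ)⁻¹) (q μ) * d1Sym s μ
        * (((DeltaXir n 0 q : ℝ) : ℂ))⁻¹‖
      ≤ Delta1r 0 s / T4GaugeActionRate.gam0 d * Uq s q * vMaj s q μ * |s μ| * Dq q :=
    norm_mul_le_of_le (norm_mul_le_of_le (norm_mul_le_of_le (norm_mul_le_of_le hC hU) hV) hE) hD
  have hbP : ‖bP n a μ q s‖
      ≤ |q μ| * Uq s q * Dq q * Dq q * (Delta1r 0 s ^ 2 / T4GaugeActionRate.gam0 d)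
          + Delta1r 0 s / T4GaugeActionRate.gam0 d * Uq s q * vMaj s q μ * |s μ| * Dq q := by
    unfold bP; exact (norm_sub_le _ _).trans (add_le_add h1 h2)
  unfold bR
  rw [norm_mul, norm_inv, Complex.norm_real, Real.norm_eq_abs, abs_of_pos hΔ]
  refine (mul_le_mul_of_nonneg_right hbP (by positivity)).trans (le_of_eq ?_)
  unfold bMajA; field_simp

/-- `|BrP| ≤ 1 + a/4 + a·π²d/16` (`0 ≤ S₁ ≤ ¼`, `|v_μ(p′)|² ≤ 1`, `Δ(p′) ≤ (π²/4)Δ₀ ≤ π²d`, `0 ≤ S₂ ≤ 1/16`).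
[folklore] -/
theorem BrP_abs_le (hn : 1 ≤ n) (a : ℝ) (ha : 0 < a) (μ : Fin d) {s : Fin d → ℝ}
    (hs : ∀ ν, |s ν| ≤ Real.pi) : |BrP n a μ s| ≤ 1 + a / 4 + a * (Real.pi ^ 2 * d / 16) := by
  have h1 := S1x_le hn μ s hs
  have h1' := S1x_nonneg (n := n) μ s
  have h2 := S2x_le hn s hs
  have h2' := S2x_nonneg (n := n) s
  have hu := uFactorr_le_one n hn 0 (s μ)
  have hu' := uFactorr_nonneg n 0 (s μ)
  have hD := DeltaXir_le_Delta1r n s hs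
  have hD' := DeltaXir_nonneg n 0 le_rfl s
  have h4 := Delta1r_le s
  have hπ : 0 ≤ Real.pi ^ 2 := sq_nonneg _
  have hP : uFactorr n 0 (s μ) * DeltaXir n 0 s * S2x n s ≤ Real.pi ^ 2 * d / 16 := by
    have hΔd : DeltaXir n 0 s ≤ Real.pi ^ 2 * d := hD.trans (by nlinarith [hπ])
    have h12 : uFactorr n 0 (s μ) * DeltaXir n 0 s ≤ 1 * (Real.pi ^ 2 * d) := mul_le_mul hu hΔd hD' zero_le_one
    have h123 : uFactorr n 0 (s μ) * DeltaXir n 0 s * S2x n s ≤ 1 * (Real.pi ^ 2 * d) * (1 / 16) :=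
      mul_le_mul h12 h2 h2' (by positivity)
    linarith
  have hP' : 0 ≤ uFactorr n 0 (s μ) * DeltaXir n 0 s * S2x n s := mul_nonneg (mul_nonneg hu' hD') h2'
  unfold BrP
  rw [abs_le]
  constructor <;> nlinarith

/-- `(Δ₀/Δ(p′))² ≤ 1`. [folklore] -/
theorem ratio_sq_le_one (hn : 1 ≤ n) {s : Fin d → ℝ} (hs : ∀ ν, |s ν| ≤ Real.pi) (ν₀ : Fin d)
    (hν₀ : s ν₀ ≠ 0) : 0 ≤ (Delta1r 0 s / DeltaXir n 0 s) ^ 2 ∧ (Delta1r 0 s / DeltaXir n 0 s) ^ 2 ≤ 1 := by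
  have hΔ := Delta1r_pos s hs ν₀ hν₀
  have hle : Delta1r 0 s ≤ DeltaXir n 0 s := by
    have := Delta1r_le_DeltaXir_shift n hn (fun _ => 0) s; rwa [shiftr_zero] at this
  have hD : 0 < DeltaXir n 0 s := hΔ.trans_le hle
  have hr : Delta1r 0 s / DeltaXir n 0 s ≤ 1 := (div_le_one hD).mpr hle
  have hr0 : 0 ≤ Delta1r 0 s / DeltaXir n 0 s := by positivity
  exact ⟨sq_nonneg _, by nlinarith⟩

/-- the majorant of the zone-centre scalar: `|rS| ≤ (1 + a/4 + aπ²d/16)/(aγ₀²)` (`(Δ₀/Δ)² ≤ 1`, `ψ₂ ≥ γ₀`,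
`Δ₀φ_μ ≥ aγ₀`). [cite: Balaban1984PropagatorsI, (1.85)–(1.88) p.32] [folklore] -/
theorem rS_abs_le (hn : 1 ≤ n) (a : ℝ) (ha : 0 < a) (μ : Fin d) {s : Fin d → ℝ} (hs : ∀ ν, |s ν| ≤ Real.pi)
    (ν₀ : Fin d) (hν₀ : s ν₀ ≠ 0) :
    |rS n a μ s| ≤ (1 + a / 4 + a * (Real.pi ^ 2 * d / 16)) / (a * T4GaugeActionRate.gam0 d ^ 2) := by
  have hg := T4GaugeActionRate.gam0_pos d
  have hΔ := Delta1r_pos s hs ν₀ hν₀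
  obtain ⟨hr0, hr1⟩ := ratio_sq_le_one hn hs ν₀ hν₀
  have hψ := T4GaugeActionRate.psi163_lower n hn s hs ν₀ hν₀
  have hψ0 : 0 < T4GaugeActionRate.psi163 n s := hg.trans_le hψ
  have hφ : a * T4GaugeActionRate.gam0 d ≤ Delta1r 0 s * phiMu n a μ s := by
    have := ineq185_lower n hn a ha.le μ s hs ν₀ hν₀; unfold T4GaugeActionRate.gam0; exact this
  have hφ0 : 0 < Delta1r 0 s * phiMu n a μ s := mul_pos hΔ (B5QGQ199Rate.phiMu_pos n a ha.le μ s)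
  have hB := BrP_abs_le hn a ha μ hs
  have i1 : (T4GaugeActionRate.psi163 n s)⁻¹ ≤ (T4GaugeActionRate.gam0 d)⁻¹ := inv_anti₀ hg hψ
  have i2 : (Delta1r 0 s * phiMu n a μ s)⁻¹ ≤ (a * T4GaugeActionRate.gam0 d)⁻¹ :=
    inv_anti₀ (by positivity) hφ
  unfold rS
  rw [abs_mul, abs_mul, abs_mul, abs_of_nonneg hr0, abs_of_pos (inv_pos.mpr hψ0),
    abs_of_pos (inv_pos.mpr hφ0)]
  calc (Delta1r 0 s / DeltaXir n 0 s) ^ 2 * (T4GaugeActionRate.psi163 n s)⁻¹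
        * (Delta1r 0 s * phiMu n a μ s)⁻¹ * |BrP n a μ s|
      ≤ 1 * (T4GaugeActionRate.gam0 d)⁻¹ * (a * T4GaugeActionRate.gam0 d)⁻¹
        * (1 + a / 4 + a * (Real.pi ^ 2 * d / 16)) := by
        gcongr
    _ = (1 + a / 4 + a * (Real.pi ^ 2 * d / 16)) / (a * T4GaugeActionRate.gam0 d ^ 2) := by
        field_simp

/-- **the zone-centre bracket is `O(|p′_μ|)`**: `‖bR_μ(p′)‖ ≤ |p′_μ|·(1 + a/4 + aπ²d/16)/(aγ₀²)` — the
printed «well defined by continuity for `p′ = 0`, and we even get an additional factor `Δ₀(p′)`» with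
constants. [cite: Balaban1984PropagatorsI, (1.88) p.32] [folklore] -/
theorem norm_bR_zero_le (hn : 1 ≤ n) (a : ℝ) (ha : 0 < a) (μ : Fin d) {s : Fin d → ℝ}
    (hs : ∀ ν, |s ν| ≤ Real.pi) (hs0 : s ≠ 0) :
    ‖bR n a μ s s‖ ≤ |s μ| * ((1 + a / 4 + a * (Real.pi ^ 2 * d / 16)) / (a * T4GaugeActionRate.gam0 d ^ 2)) := by
  obtain ⟨ν₀, hν₀⟩ : ∃ ν, s ν ≠ 0 := Function.ne_iff.mp hs0
  have hsn : ∀ ν, |s ν| ≤ Real.pi * n := fun ν => by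
    have : (1 : ℝ) ≤ n := by exact_mod_cast hn
    nlinarith [hs ν, abs_nonneg (s ν), Real.pi_pos]
  rw [bR_zero_eq hn a ha s hs hs0 μ]
  have h1 := norm_conj_fdq_le hn (s μ)
  have h2 := norm_uWeight_le_one hn hsn
  have h3 : ‖((rS n a μ s : ℝ) : ℂ)‖
      ≤ (1 + a / 4 + a * (Real.pi ^ 2 * d / 16)) / (a * T4GaugeActionRate.gam0 d ^ 2) := by
    rw [Complex.norm_real, Real.norm_eq_abs]; exact rS_abs_le hn a ha μ hs ν₀ hν₀
  calc _ ≤ |s μ| * 1 * ((1 + a / 4 + a * (Real.pi ^ 2 * d / 16)) / (a * T4GaugeActionRate.gam0 d ^ 2)) :=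
        norm_mul_le_of_le (norm_mul_le_of_le h1 h2) h3
    _ = _ := by rw [mul_one]

/-- **the combined zone-centre diagonal is bounded**: `0 < dZ ≤ (1 + a/4)/(aγ₀)` (`Δ(p′) ≥ Δ₀`,
`Δ₀φ_μ ≥ aγ₀`, `S₁ ≤ ¼`) — the printed «can be extended by continuity to `p′ = 0`».
[cite: Balaban1984PropagatorsI, (1.87) p.32] [folklore] -/
theorem dZ_bounds (hn : 1 ≤ n) (a : ℝ) (ha : 0 < a) (μ : Fin d) {s : Fin d → ℝ} (hs : ∀ ν, |s ν| ≤ Real.pi)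
    (ν₀ : Fin d) (hν₀ : s ν₀ ≠ 0) :
    0 < dZ n a μ s ∧ dZ n a μ s ≤ (1 + a / 4) / (a * T4GaugeActionRate.gam0 d) := by
  have hg := T4GaugeActionRate.gam0_pos d
  have hΔ := Delta1r_pos s hs ν₀ hν₀
  have hle : Delta1r 0 s ≤ DeltaXir n 0 s := by
    have := Delta1r_le_DeltaXir_shift n hn (fun _ => 0) s; rwa [shiftr_zero] at this
  have hφp := B5QGQ199Rate.phiMu_pos n a ha.le μ s
  have hφ : a * T4GaugeActionRate.gam0 d ≤ Delta1r 0 s * phiMu n a μ s := by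
    have := ineq185_lower n hn a ha.le μ s hs ν₀ hν₀; unfold T4GaugeActionRate.gam0; exact this
  have h1 := S1x_le hn μ s hs
  have h1' := S1x_nonneg (n := n) μ s
  have hden : a * T4GaugeActionRate.gam0 d ≤ phiMu n a μ s * DeltaXir n 0 s := by
    nlinarith [mul_le_mul_of_nonneg_left hle hφp.le]
  have hDpos : 0 < DeltaXir n 0 s := hΔ.trans_le hle
  have hden0 : 0 < phiMu n a μ s * DeltaXir n 0 s := mul_pos hφp hDpos
  unfold dZ
  refine ⟨by positivity, ?_⟩
  rw [div_le_div_iff₀ hden0 (by positivity)]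
  nlinarith [mul_le_mul hden (show 1 + a * S1x n μ s ≤ 1 + a / 4 by nlinarith) (by positivity) hden0.le]

end Majorants

/-! ## §5 «We successively replace each factor by the corresponding one … and bound the error» — η-RATES -/

section Rates

variable {N R : ℕ} [NeZero N] [NeZero R]

/-- the constant of the `xP` rate: `(π/2)^{d+1} + π/2 + π³/48`. [folklore] -/
def Ax (d : ℕ) : ℝ := (Real.pi / 2) ^ (d + 1) + Real.pi / 2 + Real.pi ^ 3 / 48

/-- the `|q|₁/N`-constant of the `bR` rate: `1 + (π/2)^{d+1} + π/2 + π³/24`. [folklore] -/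
def Ab (d : ℕ) : ℝ := 1 + (Real.pi / 2) ^ (d + 1) + Real.pi / 2 + Real.pi ^ 3 / 24

/-- the `N⁻²`-constant of the `bR` rate: `4d(C_φ + C_ψ)/γ₀`. [folklore] -/
def Bb (d : ℕ) : ℝ := 4 * d * (Cphi + Cpsi) / T4GaugeActionRate.gam0 d

omit [NeZero N] [NeZero R] in
/-- **η-RATE OF `xP`** (King (4.29), (4.30), (4.31) chained by «xy − zw = …»):
`‖xP^{(N)}_μ(q) − xP^{(RN)}_μ(q)‖ ≤ Ax·(|q|₁/N)·xMaj_μ(q)`. [cite: King1986, Lemma 4.4–(4.31) p.673] [folklore] -/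
theorem xP_rate (hN : 1 ≤ N) (hR : 1 ≤ R) {s q : Fin d → ℝ} (hs : ∀ ν, |s ν| ≤ Real.pi)
    (hq : ∀ ν, |q ν| ≤ Real.pi * N) (hq0 : 0 < momSq q) (hrep : ∀ ν, ∃ m : ℤ, q ν = s ν + 2 * Real.pi * m)
    (μ : Fin d) :
    ‖xP N μ q - xP (R * N) μ q‖ ≤ Ax d * ((∑ ν, |q ν|) / N) * xMaj s q μ := by
  have hRN := one_le_RN hN hR
  have hqRN : ∀ ν, |q ν| ≤ Real.pi * (R * N : ℕ) := fun ν => zone_RN hR (hq ν)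
  obtain ⟨m, hm⟩ := hrep μ
  have hπ := Real.pi_pos
  set ε := (∑ ν, |q ν|) / (N : ℝ) with hε
  have hε0 : 0 ≤ ε := by positivity
  have hU : ‖uWeight ((N : ℝ)⁻¹) q‖ ≤ Uq s q := norm_uWeight_le_vMaj hN hs hq hrep
  have hV : ‖uFac ((N : ℝ)⁻¹) (q μ)‖ ≤ vMaj s q μ := norm_uFac_le_vMaj hN (hs μ) (hq μ) m hm
  have hV' : ‖uFac (((R * N : ℕ) : ℝ)⁻¹) (q μ)‖ ≤ vMaj s q μ := norm_uFac_le_vMaj hRN (hs μ) (hqRN μ) m hm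
  have hD' : ‖(((DeltaXir (R * N) 0 q : ℝ) : ℂ))⁻¹‖ ≤ Dq q := norm_inv_DeltaXir_le hRN hqRN hq0
  have rU : ‖uWeight ((N : ℝ)⁻¹) q - uWeight (((R * N : ℕ) : ℝ)⁻¹) q‖
      ≤ ((Real.pi / 2) ^ (d + 1) * ε) * Uq s q := by
    refine (uWeight_rate hN hR hq).trans ?_
    rw [mul_assoc, mul_assoc]
    exact mul_le_mul_of_nonneg_left (mul_le_mul_of_nonneg_left hU hε0) (by positivity)
  have rV : ‖uFac ((N : ℝ)⁻¹) (q μ) - uFac (((R * N : ℕ) : ℝ)⁻¹) (q μ)‖ ≤ (Real.pi / 2 * ε) * vMaj s q μ := by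
    refine (uFac_rate hN hR (hq μ)).trans ?_
    have h1 : |q μ| / N ≤ ε := div_le_div_of_nonneg_right (abs_le_sum_abs q μ) (by positivity)
    exact mul_le_mul (mul_le_mul_of_nonneg_left h1 (by positivity)) hV (norm_nonneg _) (by positivity)
  have rD : ‖(((DeltaXir N 0 q : ℝ) : ℂ))⁻¹ - (((DeltaXir (R * N) 0 q : ℝ) : ℂ))⁻¹‖
      ≤ (Real.pi ^ 3 / 48 * ε) * Dq q := by
    rw [norm_inv_ofReal_sub]; exact inv_DeltaXir_sub_le hN hR hq hq0
  have step1 := rate_mul hU hV' rU rV (by positivity)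
  have hUV : ‖uWeight ((N : ℝ)⁻¹) q * uFac ((N : ℝ)⁻¹) (q μ)‖ ≤ Uq s q * vMaj s q μ :=
    norm_mul_le_of_le hU hV
  have step2 := rate_mul hUV hD' step1 rD (by positivity)
  unfold xP xMaj
  refine step2.trans (le_of_eq ?_)
  unfold Ax; ring

/-- the regular product `Δ₀φ_μ ≥ aγ₀` ((1.85)) inverted: `0 < (Δ₀φ_μ)⁻¹ ≤ (aγ₀)⁻¹`. [folklore] -/
theorem inv_D0phi_bounds {n : ℕ} [NeZero n] (hn : 1 ≤ n) (a : ℝ) (ha : 0 < a) (μ : Fin d) {s : Fin d → ℝ}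
    (hs : ∀ ν, |s ν| ≤ Real.pi) (ν₀ : Fin d) (hν₀ : s ν₀ ≠ 0) :
    0 < (Delta1r 0 s * phiMu n a μ s)⁻¹
      ∧ (Delta1r 0 s * phiMu n a μ s)⁻¹ ≤ 1 / (a * T4GaugeActionRate.gam0 d) := by
  have hΔ := Delta1r_pos s hs ν₀ hν₀
  have hg := T4GaugeActionRate.gam0_pos d
  have hφ := B5QGQ199Rate.phiMu_pos n a ha.le μ s
  have hl : a * T4GaugeActionRate.gam0 d ≤ Delta1r 0 s * phiMu n a μ s := by
    have := ineq185_lower n hn a ha.le μ s hs ν₀ hν₀; unfold T4GaugeActionRate.gam0; exact this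
  refine ⟨by positivity, ?_⟩
  rw [one_div]; exact inv_anti₀ (by positivity) hl

/-- **η-RATE OF `(Δ₀φ_μ)⁻¹`**: `|(Δ₀φ^{(N)})⁻¹ − (Δ₀φ^{(RN)})⁻¹| ≤ aΔ₀C_φN⁻²·(aγ₀)⁻²` (the sibling's
`Delta0_phiMu_rate` through `|x⁻¹ − y⁻¹| ≤ |x − y|·L²`). [cite: Balaban1984PropagatorsI, (1.85) p.32] [folklore] -/
theorem inv_D0phi_rate (hN : 1 ≤ N) (hR : 1 ≤ R) (a : ℝ) (ha : 0 < a) (μ : Fin d) {s : Fin d → ℝ}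
    (hs : ∀ ν, |s ν| ≤ Real.pi) (ν₀ : Fin d) (hν₀ : s ν₀ ≠ 0) :
    |(Delta1r 0 s * phiMu N a μ s)⁻¹ - (Delta1r 0 s * phiMu (R * N) a μ s)⁻¹|
      ≤ a * (Delta1r 0 s * (Cphi * ((N : ℝ) ^ 2)⁻¹)) * (1 / (a * T4GaugeActionRate.gam0 d)) ^ 2 := by
  have hRN := one_le_RN hN hR
  have hg := T4GaugeActionRate.gam0_pos d
  obtain ⟨hx, hxL⟩ := inv_D0phi_bounds hN a ha μ hs ν₀ hν₀
  obtain ⟨hy, hyL⟩ := inv_D0phi_bounds hRN a ha μ hs ν₀ hν₀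
  have hr := (B5QGQ199Rate.Delta0_phiMu_rate hN hR a ha.le μ s hs ν₀ hν₀).1
  have haγ : 0 < a * T4GaugeActionRate.gam0 d := by positivity
  have hx' := inv_pos.mp hx
  have hy' := inv_pos.mp hy
  refine abs_inv_sub_inv_le hx' hy' (by positivity) ?_ ?_ hr
  · rw [one_div, ← div_eq_inv_mul, one_le_div haγ]; rw [one_div] at hxL
    have := (inv_le_inv₀ hx' haγ).mp ?_
    · exact this
    · simpa using hxL
  · rw [one_div, ← div_eq_inv_mul, one_le_div haγ]; rw [one_div] at hyL
    have := (inv_le_inv₀ hy' haγ).mp ?_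
    · exact this
    · simpa using hyL

/-- **η-RATE OF `cX = aφ_μ⁻¹`** through the regular product `Δ₀φ_μ` ((1.85)):
`|cX^{(N)} − cX^{(RN)}| ≤ (4dC_φ/γ₀)N⁻²·(Δ₀/γ₀)` (relative to its majorant). [folklore] -/
theorem cX_rate (hN : 1 ≤ N) (hR : 1 ≤ R) (a : ℝ) (ha : 0 < a) (μ : Fin d) {s : Fin d → ℝ}
    (hs : ∀ ν, |s ν| ≤ Real.pi) (ν₀ : Fin d) (hν₀ : s ν₀ ≠ 0) :
    |cX N a μ s - cX (R * N) a μ s|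
      ≤ 4 * d * Cphi / T4GaugeActionRate.gam0 d * ((N : ℝ) ^ 2)⁻¹
          * (Delta1r 0 s / T4GaugeActionRate.gam0 d) := by
  have hRN := one_le_RN hN hR
  have hΔ := Delta1r_pos s hs ν₀ hν₀
  have h4 := Delta1r_le s
  have hg := T4GaugeActionRate.gam0_pos d
  have hC := B5ActionRate166.Cphi_pos
  have hφN := B5QGQ199Rate.phiMu_pos N a ha.le μ s
  have hφRN := B5QGQ199Rate.phiMu_pos (R * N) a ha.le μ s
  have key := inv_D0phi_rate hN hR a ha μ hs ν₀ hν₀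
  have e : ∀ φ : ℝ, φ ≠ 0 → a / φ = a * Delta1r 0 s * (Delta1r 0 s * φ)⁻¹ := fun φ hφ => by
    field_simp
  unfold cX
  rw [e _ hφN.ne', e _ hφRN.ne', ← mul_sub, abs_mul, abs_of_pos (by positivity : 0 < a * Delta1r 0 s)]
  calc a * Delta1r 0 s * |(Delta1r 0 s * phiMu N a μ s)⁻¹ - (Delta1r 0 s * phiMu (R * N) a μ s)⁻¹|
      ≤ a * Delta1r 0 s * (a * (Delta1r 0 s * (Cphi * ((N : ℝ) ^ 2)⁻¹))
          * (1 / (a * T4GaugeActionRate.gam0 d)) ^ 2) := mul_le_mul_of_nonneg_left key (by positivity)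
    _ = Delta1r 0 s * Cphi / T4GaugeActionRate.gam0 d * ((N : ℝ) ^ 2)⁻¹
          * (Delta1r 0 s / T4GaugeActionRate.gam0 d) := by field_simp
    _ ≤ 4 * d * Cphi / T4GaugeActionRate.gam0 d * ((N : ℝ) ^ 2)⁻¹
          * (Delta1r 0 s / T4GaugeActionRate.gam0 d) := by gcongr

/-- **η-RATE OF THE x-BLOCK ENTRY** `cX_μ·xP_μ(q)·conj xP_μ(q′)` of (1.83) (all pairs of aliases):
`≤ (4dC_φγ₀⁻¹N⁻² + Ax|q|₁/N + Ax|q′|₁/N)·(Δ₀/γ₀)·xMaj_μ(q)·xMaj_μ(q′)`.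
[cite: Balaban1984PropagatorsI, (1.83) p.31; King1986, (4.29)–(4.31) p.673] [folklore] -/
theorem xEntry_rate (hN : 1 ≤ N) (hR : 1 ≤ R) (a : ℝ) (ha : 0 < a) (μ : Fin d) {s q q' : Fin d → ℝ}
    (hs : ∀ ν, |s ν| ≤ Real.pi) (ν₀ : Fin d) (hν₀ : s ν₀ ≠ 0)
    (hq : ∀ ν, |q ν| ≤ Real.pi * N) (hrep : ∀ ν, ∃ m : ℤ, q ν = s ν + 2 * Real.pi * m)
    (hq' : ∀ ν, |q' ν| ≤ Real.pi * N) (hrep' : ∀ ν, ∃ m : ℤ, q' ν = s ν + 2 * Real.pi * m) :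
    ‖((cX N a μ s : ℝ) : ℂ) * xP N μ q * conj (xP N μ q')
        - ((cX (R * N) a μ s : ℝ) : ℂ) * xP (R * N) μ q * conj (xP (R * N) μ q')‖
      ≤ (4 * d * Cphi / T4GaugeActionRate.gam0 d * ((N : ℝ) ^ 2)⁻¹
            + Ax d * ((∑ ν, |q ν|) / N) + Ax d * ((∑ ν, |q' ν|) / N))
          * (Delta1r 0 s / T4GaugeActionRate.gam0 d * xMaj s q μ * xMaj s q' μ) := by
  have hRN := one_le_RN hN hR
  have hqRN : ∀ ν, |q ν| ≤ Real.pi * (R * N : ℕ) := fun ν => zone_RN hR (hq ν)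
  have hqRN' : ∀ ν, |q' ν| ≤ Real.pi * (R * N : ℕ) := fun ν => zone_RN hR (hq' ν)
  have hq0 := momSq_pos_of_rep hs ν₀ hν₀ hrep
  have hq0' := momSq_pos_of_rep hs ν₀ hν₀ hrep'
  have hg := T4GaugeActionRate.gam0_pos d
  have hCφ := B5ActionRate166.Cphi_pos
  have hπ := Real.pi_pos
  have hC : ‖((cX N a μ s : ℝ) : ℂ)‖ ≤ Delta1r 0 s / T4GaugeActionRate.gam0 d :=
    norm_cX_le hN a ha μ hs ν₀ hν₀
  have hX : ‖xP N μ q‖ ≤ xMaj s q μ := norm_xP_le hN hs hq hq0 hrep μ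
  have hX' : ‖xP (R * N) μ q‖ ≤ xMaj s q μ := norm_xP_le hRN hs hqRN hq0 hrep μ
  have hXc' : ‖conj (xP (R * N) μ q')‖ ≤ xMaj s q' μ := by
    rw [Complex.norm_conj]; exact norm_xP_le hRN hs hqRN' hq0' hrep' μ
  have rC : ‖((cX N a μ s : ℝ) : ℂ) - ((cX (R * N) a μ s : ℝ) : ℂ)‖
      ≤ (4 * d * Cphi / T4GaugeActionRate.gam0 d * ((N : ℝ) ^ 2)⁻¹)
          * (Delta1r 0 s / T4GaugeActionRate.gam0 d) := by
    rw [← Complex.ofReal_sub, Complex.norm_real, Real.norm_eq_abs]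
    exact cX_rate hN hR a ha μ hs ν₀ hν₀
  have rX := xP_rate hN hR hs hq hq0 hrep μ
  have rXc : ‖conj (xP N μ q') - conj (xP (R * N) μ q')‖ ≤ Ax d * ((∑ ν, |q' ν|) / N) * xMaj s q' μ := by
    rw [← map_sub, Complex.norm_conj]; exact xP_rate hN hR hs hq' hq0' hrep' μ
  have hAx : 0 ≤ Ax d := by unfold Ax; positivity
  have step1 := rate_mul hC hX' rC rX (by positivity)
  have hCX : ‖((cX N a μ s : ℝ) : ℂ) * xP N μ q‖ ≤ Delta1r 0 s / T4GaugeActionRate.gam0 d * xMaj s q μ :=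
    norm_mul_le_of_le hC hX
  have step2 := rate_mul hCX hXc' step1 rXc (by positivity)
  exact step2.trans (le_of_eq (by ring))

/-- **η-RATE OF THE REGULARISED BRACKET `bR_μ(q)`, ALIASED FORM** (all `q`; at `q = p′` use the centre form):
`‖bR^{(N)} − bR^{(RN)}‖ ≤ (Ab·|q|₁/N + Bb·N⁻²)·bMajA_μ(q)` — the five printed factors of each term of
`b(l, μ)` replaced one at a time. [cite: Balaban1984PropagatorsI, (1.83) p.31; King1986, p.673] [folklore] -/
theorem bR_rate_alias (hN : 1 ≤ N) (hR : 1 ≤ R) (a : ℝ) (ha : 0 < a) (μ : Fin d) {s q : Fin d → ℝ}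
    (hs : ∀ ν, |s ν| ≤ Real.pi) (ν₀ : Fin d) (hν₀ : s ν₀ ≠ 0)
    (hq : ∀ ν, |q ν| ≤ Real.pi * N) (hrep : ∀ ν, ∃ m : ℤ, q ν = s ν + 2 * Real.pi * m) :
    ‖bR N a μ q s - bR (R * N) a μ q s‖
      ≤ (Ab d * ((∑ ν, |q ν|) / N) + Bb d * ((N : ℝ) ^ 2)⁻¹) * bMajA d s q μ := by
  have hRN := one_le_RN hN hR
  have hqRN : ∀ ν, |q ν| ≤ Real.pi * (R * N : ℕ) := fun ν => zone_RN hR (hq ν)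
  have hq0 := momSq_pos_of_rep hs ν₀ hν₀ hrep
  obtain ⟨m, hm⟩ := hrep μ
  have hg := T4GaugeActionRate.gam0_pos d
  have hCφ := B5ActionRate166.Cphi_pos
  have hCψ := B5ActionRate166.Cpsi_pos
  have hΔ := Delta1r_pos s hs ν₀ hν₀
  have hπ := Real.pi_pos
  set ε := (∑ ν, |q ν|) / (N : ℝ) with hε
  have hε0 : 0 ≤ ε := by positivity
  set ν2 := ((N : ℝ) ^ 2)⁻¹ with hν2
  have hν20 : 0 ≤ ν2 := by positivity
  -- majorants (level N for left factors, level RN for right factors)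
  have hF : ‖conj (fdq ((N : ℝ)⁻¹) (q μ))‖ ≤ |q μ| := norm_conj_fdq_le hN (q μ)
  have hU : ‖uWeight ((N : ℝ)⁻¹) q‖ ≤ Uq s q := norm_uWeight_le_vMaj hN hs hq hrep
  have hU' : ‖uWeight (((R * N : ℕ) : ℝ)⁻¹) q‖ ≤ Uq s q := norm_uWeight_le_vMaj hRN hs hqRN hrep
  have hV' : ‖uFac (((R * N : ℕ) : ℝ)⁻¹) (q μ)‖ ≤ vMaj s q μ := norm_uFac_le_vMaj hRN (hs μ) (hqRN μ) m hm
  have hD : ‖(((DeltaXir N 0 q : ℝ) : ℂ))⁻¹‖ ≤ Dq q := norm_inv_DeltaXir_le hN hq hq0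
  have hD' : ‖(((DeltaXir (R * N) 0 q : ℝ) : ℂ))⁻¹‖ ≤ Dq q := norm_inv_DeltaXir_le hRN hqRN hq0
  have hΨ' : ‖(((psiSum (R * N) s : ℝ) : ℂ))⁻¹‖ ≤ Delta1r 0 s ^ 2 / T4GaugeActionRate.gam0 d :=
    norm_inv_psiSum_le hRN hs ν₀ hν₀
  have hC : ‖((cX N a μ s : ℝ) : ℂ)‖ ≤ Delta1r 0 s / T4GaugeActionRate.gam0 d :=
    norm_cX_le hN a ha μ hs ν₀ hν₀
  have hE' : ‖d1Sym s μ‖ ≤ |s μ| := norm_d1Sym_le s μ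
  -- factor rates
  have rF : ‖conj (fdq ((N : ℝ)⁻¹) (q μ)) - conj (fdq (((R * N : ℕ) : ℝ)⁻¹) (q μ))‖ ≤ (1 * ε) * |q μ| := by
    rw [← map_sub, Complex.norm_conj]
    refine (fdq_rate hN hR (q μ)).trans ?_
    have h1 : |q μ| / N ≤ ε := div_le_div_of_nonneg_right (abs_le_sum_abs q μ) (by positivity)
    rw [one_mul]; exact mul_le_mul_of_nonneg_right h1 (abs_nonneg _)
  have rU : ‖uWeight ((N : ℝ)⁻¹) q - uWeight (((R * N : ℕ) : ℝ)⁻¹) q‖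
      ≤ ((Real.pi / 2) ^ (d + 1) * ε) * Uq s q := by
    refine (uWeight_rate hN hR hq).trans ?_
    rw [mul_assoc, mul_assoc]
    exact mul_le_mul_of_nonneg_left (mul_le_mul_of_nonneg_left hU hε0) (by positivity)
  have rV : ‖uFac ((N : ℝ)⁻¹) (q μ) - uFac (((R * N : ℕ) : ℝ)⁻¹) (q μ)‖ ≤ (Real.pi / 2 * ε) * vMaj s q μ := by
    refine (uFac_rate hN hR (hq μ)).trans ?_
    have h1 : |q μ| / N ≤ ε := div_le_div_of_nonneg_right (abs_le_sum_abs q μ) (by positivity)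
    have hV : ‖uFac ((N : ℝ)⁻¹) (q μ)‖ ≤ vMaj s q μ := norm_uFac_le_vMaj hN (hs μ) (hq μ) m hm
    exact mul_le_mul (mul_le_mul_of_nonneg_left h1 (by positivity)) hV (norm_nonneg _) (by positivity)
  have rD : ‖(((DeltaXir N 0 q : ℝ) : ℂ))⁻¹ - (((DeltaXir (R * N) 0 q : ℝ) : ℂ))⁻¹‖
      ≤ (Real.pi ^ 3 / 48 * ε) * Dq q := by
    rw [norm_inv_ofReal_sub]; exact inv_DeltaXir_sub_le hN hR hq hq0
  have rΨ : ‖(((psiSum N s : ℝ) : ℂ))⁻¹ - (((psiSum (R * N) s : ℝ) : ℂ))⁻¹‖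
      ≤ (4 * d * Cpsi / T4GaugeActionRate.gam0 d * ν2) * (Delta1r 0 s ^ 2 / T4GaugeActionRate.gam0 d) :=
    inv_psiSum_rate hN hR hs ν₀ hν₀
  have rC : ‖((cX N a μ s : ℝ) : ℂ) - ((cX (R * N) a μ s : ℝ) : ℂ)‖
      ≤ (4 * d * Cphi / T4GaugeActionRate.gam0 d * ν2) * (Delta1r 0 s / T4GaugeActionRate.gam0 d) := by
    rw [← Complex.ofReal_sub, Complex.norm_real, Real.norm_eq_abs]
    exact cX_rate hN hR a ha μ hs ν₀ hν₀
  have rE : ‖d1Sym s μ - d1Sym s μ‖ ≤ (0 : ℝ) * |s μ| := by simp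
  -- the first term: conj D · ū · Δ⁻¹ · Δ⁻¹ · ψ⁻¹
  have a1 := rate_mul hF hU' rF rU (by positivity)
  have m1 : ‖conj (fdq ((N : ℝ)⁻¹) (q μ)) * uWeight ((N : ℝ)⁻¹) q‖ ≤ |q μ| * Uq s q := norm_mul_le_of_le hF hU
  have a2 := rate_mul m1 hD' a1 rD (by positivity)
  have m2 := norm_mul_le_of_le m1 hD
  have a3 := rate_mul m2 hD' a2 rD (by positivity)
  have m3 := norm_mul_le_of_le m2 hD
  have a4 := rate_mul m3 hΨ' a3 rΨ (by positivity)
  -- the second term: cX · ū · f · ∂₁ · Δ⁻¹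
  have b1 := rate_mul hC hU' rC rU (by positivity)
  have n1 := norm_mul_le_of_le hC hU
  have b2 := rate_mul n1 hV' b1 rV (by positivity)
  have n2 := norm_mul_le_of_le n1 (norm_uFac_le_vMaj hN (hs μ) (hq μ) m hm)
  have b3 := rate_mul n2 hE' b2 rE (by positivity)
  have n3 := norm_mul_le_of_le n2 hE'
  have b4 := rate_mul n3 hD' b3 rD (by positivity)
  -- assemble
  have hsub : bR N a μ q s - bR (R * N) a μ q s
      = (bP N a μ q s - bP (R * N) a μ q s) * (((Delta1r 0 s : ℝ) : ℂ))⁻¹ := by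
    unfold bR; ring
  rw [hsub, norm_mul, norm_inv, Complex.norm_real, Real.norm_eq_abs, abs_of_pos hΔ]
  have hbP : ‖bP N a μ q s - bP (R * N) a μ q s‖
      ≤ (1 * ε + (Real.pi / 2) ^ (d + 1) * ε + Real.pi ^ 3 / 48 * ε + Real.pi ^ 3 / 48 * ε
            + 4 * d * Cpsi / T4GaugeActionRate.gam0 d * ν2)
          * (|q μ| * Uq s q * Dq q * Dq q * (Delta1r 0 s ^ 2 / T4GaugeActionRate.gam0 d))
        + (4 * d * Cphi / T4GaugeActionRate.gam0 d * ν2 + (Real.pi / 2) ^ (d + 1) * ε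
            + Real.pi / 2 * ε + 0 + Real.pi ^ 3 / 48 * ε)
          * (Delta1r 0 s / T4GaugeActionRate.gam0 d * Uq s q * vMaj s q μ * |s μ| * Dq q) := by
    have e : bP N a μ q s - bP (R * N) a μ q s
        = (conj (fdq ((N : ℝ)⁻¹) (q μ)) * uWeight ((N : ℝ)⁻¹) q * (((DeltaXir N 0 q : ℝ) : ℂ))⁻¹
              * (((DeltaXir N 0 q : ℝ) : ℂ))⁻¹ * (((psiSum N s : ℝ) : ℂ))⁻¹
            - conj (fdq (((R * N : ℕ) : ℝ)⁻¹) (q μ)) * uWeight (((R * N : ℕ) : ℝ)⁻¹) q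
              * (((DeltaXir (R * N) 0 q : ℝ) : ℂ))⁻¹ * (((DeltaXir (R * N) 0 q : ℝ) : ℂ))⁻¹
              * (((psiSum (R * N) s : ℝ) : ℂ))⁻¹)
          - (((cX N a μ s : ℝ) : ℂ) * uWeight ((N : ℝ)⁻¹) q * uFac ((N : ℝ)⁻¹) (q μ) * d1Sym s μ
              * (((DeltaXir N 0 q : ℝ) : ℂ))⁻¹
            - ((cX (R * N) a μ s : ℝ) : ℂ) * uWeight (((R * N : ℕ) : ℝ)⁻¹) q
              * uFac (((R * N : ℕ) : ℝ)⁻¹) (q μ) * d1Sym s μ * (((DeltaXir (R * N) 0 q : ℝ) : ℂ))⁻¹) := by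
      unfold bP; push_cast; ring
    rw [e]
    exact (norm_sub_le _ _).trans (add_le_add a4 b4)
  have hM1 : 0 ≤ |q μ| * Uq s q * Dq q * Dq q * (Delta1r 0 s ^ 2 / T4GaugeActionRate.gam0 d) := by
    have := Uq_nonneg s q; have := Dq_nonneg q; positivity
  have hM2 : 0 ≤ Delta1r 0 s / T4GaugeActionRate.gam0 d * Uq s q * vMaj s q μ * |s μ| * Dq q := by
    have := Uq_nonneg s q; have := Dq_nonneg q; have := vMaj_nonneg s q μ; positivity
  set εb := Ab d * ε + Bb d * ν2 with hεb
  have hε1 : 1 * ε + (Real.pi / 2) ^ (d + 1) * ε + Real.pi ^ 3 / 48 * ε + Real.pi ^ 3 / 48 * ε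
        + 4 * d * Cpsi / T4GaugeActionRate.gam0 d * ν2 ≤ εb := by
    rw [hεb]; unfold Ab Bb
    have h1 : 0 ≤ Real.pi / 2 * ε := by positivity
    have h2 : 0 ≤ 4 * d * Cphi / T4GaugeActionRate.gam0 d * ν2 := by positivity
    have e1 : Ab d * ε + Bb d * ν2 = (1 * ε + (Real.pi / 2) ^ (d + 1) * ε + Real.pi ^ 3 / 48 * ε
        + Real.pi ^ 3 / 48 * ε + 4 * d * Cpsi / T4GaugeActionRate.gam0 d * ν2)
        + (Real.pi / 2 * ε + 4 * d * Cphi / T4GaugeActionRate.gam0 d * ν2) := by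
      unfold Ab Bb; ring
    unfold Ab Bb at e1
    linarith
  have hε2 : 4 * d * Cphi / T4GaugeActionRate.gam0 d * ν2 + (Real.pi / 2) ^ (d + 1) * ε
        + Real.pi / 2 * ε + 0 + Real.pi ^ 3 / 48 * ε ≤ εb := by
    rw [hεb]
    have h1 : 0 ≤ 1 * ε + Real.pi ^ 3 / 48 * ε + 4 * d * Cpsi / T4GaugeActionRate.gam0 d * ν2 := by
      positivity
    have e1 : Ab d * ε + Bb d * ν2 = (4 * d * Cphi / T4GaugeActionRate.gam0 d * ν2
        + (Real.pi / 2) ^ (d + 1) * ε + Real.pi / 2 * ε + 0 + Real.pi ^ 3 / 48 * ε)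
        + (1 * ε + Real.pi ^ 3 / 48 * ε + 4 * d * Cpsi / T4GaugeActionRate.gam0 d * ν2) := by
      unfold Ab Bb; ring
    linarith
  calc ‖bP N a μ q s - bP (R * N) a μ q s‖ * (Delta1r 0 s)⁻¹
      ≤ (εb * (|q μ| * Uq s q * Dq q * Dq q * (Delta1r 0 s ^ 2 / T4GaugeActionRate.gam0 d))
          + εb * (Delta1r 0 s / T4GaugeActionRate.gam0 d * Uq s q * vMaj s q μ * |s μ| * Dq q))
          * (Delta1r 0 s)⁻¹ := by
        refine mul_le_mul_of_nonneg_right (hbP.trans (add_le_add ?_ ?_)) (by positivity)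
        · exact mul_le_mul_of_nonneg_right hε1 hM1
        · exact mul_le_mul_of_nonneg_right hε2 hM2
    _ = εb * bMajA d s q μ := by unfold bMajA; field_simp

/-- **η-RATE OF `cB = Δ₀²a⁻¹σ₉₉⁻¹`** (the scalar «inverse of the expression (1.86)»): `|cB^{(N)} − cB^{(RN)}|
≤ (4dC_φ/γ₀²)N⁻²` (the sibling's `inv_sigma199_reg_rate` divided by `a`).
[cite: Balaban1984PropagatorsI, (1.86) p.32] [folklore] -/
theorem cB_rate (hN : 1 ≤ N) (hR : 1 ≤ R) (a : ℝ) (ha : 0 < a) {s : Fin d → ℝ} (hs : ∀ ν, |s ν| ≤ Real.pi)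
    (ν₀ : Fin d) (hν₀ : s ν₀ ≠ 0) :
    |cB N a s - cB (R * N) a s| ≤ 4 * d * Cphi / T4GaugeActionRate.gam0 d ^ 2 * ((N : ℝ) ^ 2)⁻¹ := by
  have h := B5QGQ199Rate.inv_sigma199_reg_rate hN hR a ha.le s hs ν₀ hν₀
  have e : ∀ σ : ℝ, Delta1r 0 s ^ 2 / (a * σ) = a⁻¹ * (Delta1r 0 s ^ 2 / σ) := fun σ => by ring
  unfold cB
  rw [e, e, ← mul_sub, abs_mul, abs_of_pos (inv_pos.mpr ha)]
  calc a⁻¹ * |Delta1r 0 s ^ 2 / sigma199 N a s - Delta1r 0 s ^ 2 / sigma199 (R * N) a s|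
      ≤ a⁻¹ * (4 * d * a * (1 / T4GaugeActionRate.gam0 d ^ 2 * (Cphi * ((N : ℝ) ^ 2)⁻¹))) :=
        mul_le_mul_of_nonneg_left h (by positivity)
    _ = 4 * d * Cphi / T4GaugeActionRate.gam0 d ^ 2 * ((N : ℝ) ^ 2)⁻¹ := by field_simp

/-- **η-RATE OF THE RANK-ONE ENTRY `cB·bR_μ(q)·conj bR_ν(q′)`** of (1.83), from any majorants `B₁, B₂` and
relative rates `ε₁, ε₂` of the two brackets (`bR_rate_alias` for `l ≠ 0`, `bR_zero_rate` for `l = 0`):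
`≤ (4dC_φγ₀⁻²N⁻² + ε₁ + ε₂)·((4d+a)/a)·B₁B₂`. [cite: Balaban1984PropagatorsI, (1.83) p.31] [folklore] -/
theorem rankOne_rate_of (hN : 1 ≤ N) (hR : 1 ≤ R) (a : ℝ) (ha : 0 < a) {s q q' : Fin d → ℝ}
    (hs : ∀ ν, |s ν| ≤ Real.pi) (ν₀ : Fin d) (hν₀ : s ν₀ ≠ 0) {μ ν : Fin d} {B₁ B₂ ε₁ ε₂ : ℝ}
    (hb1 : ‖bR N a μ q s‖ ≤ B₁) (hb1' : ‖bR (R * N) a μ q s‖ ≤ B₁) (hb2' : ‖bR (R * N) a ν q' s‖ ≤ B₂)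
    (r1 : ‖bR N a μ q s - bR (R * N) a μ q s‖ ≤ ε₁ * B₁)
    (r2 : ‖bR N a ν q' s - bR (R * N) a ν q' s‖ ≤ ε₂ * B₂) (hε1 : 0 ≤ ε₁) :
    ‖((cB N a s : ℝ) : ℂ) * bR N a μ q s * conj (bR N a ν q' s)
        - ((cB (R * N) a s : ℝ) : ℂ) * bR (R * N) a μ q s * conj (bR (R * N) a ν q' s)‖
      ≤ (4 * d * Cphi / T4GaugeActionRate.gam0 d ^ 2 * ((N : ℝ) ^ 2)⁻¹ + ε₁ + ε₂)
          * ((4 * d + a) / a * B₁ * B₂) := by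
  have hRN := one_le_RN hN hR
  have hg := T4GaugeActionRate.gam0_pos d
  have hCφ := B5ActionRate166.Cphi_pos
  obtain ⟨hc1, hc2⟩ := cB_le hN a ha hs ν₀ hν₀
  have hcpos := cB_pos hN a ha hs ν₀ hν₀
  have hMB1 : 1 ≤ (4 * d + a) / a := by
    rw [le_div_iff₀ ha]; have : (0 : ℝ) ≤ 4 * d := by positivity
    linarith
  have hC : ‖((cB N a s : ℝ) : ℂ)‖ ≤ (4 * d + a) / a := by
    rw [Complex.norm_real, Real.norm_eq_abs, abs_of_pos hcpos]; exact hc1.trans hc2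
  have rC : ‖((cB N a s : ℝ) : ℂ) - ((cB (R * N) a s : ℝ) : ℂ)‖
      ≤ (4 * d * Cphi / T4GaugeActionRate.gam0 d ^ 2 * ((N : ℝ) ^ 2)⁻¹) * ((4 * d + a) / a) := by
    rw [← Complex.ofReal_sub, Complex.norm_real, Real.norm_eq_abs]
    refine (cB_rate hN hR a ha hs ν₀ hν₀).trans ?_
    exact le_mul_of_one_le_right (by positivity) hMB1
  have hb2c' : ‖conj (bR (R * N) a ν q' s)‖ ≤ B₂ := by rw [Complex.norm_conj]; exact hb2'
  have r2c : ‖conj (bR N a ν q' s) - conj (bR (R * N) a ν q' s)‖ ≤ ε₂ * B₂ := by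
    rw [← map_sub, Complex.norm_conj]; exact r2
  have step1 := rate_mul hC hb1' rC r1 (by positivity)
  have hCB : ‖((cB N a s : ℝ) : ℂ) * bR N a μ q s‖ ≤ (4 * d + a) / a * B₁ := norm_mul_le_of_le hC hb1
  have step2 := rate_mul hCB hb2c' step1 r2c (by positivity)
  exact step2.trans (le_of_eq (by ring))

/-- the rank-one entry rate for two ALIASED indices (`l, l′ ≠ 0`, or any `q, q′` with the aliased majorants):
`≤ (4dC_φγ₀⁻²N⁻² + Ab|q|₁/N + BbN⁻² + Ab|q′|₁/N + BbN⁻²)·((4d+a)/a)·bMajA_μ(q)·bMajA_ν(q′)`. [folklore] -/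
theorem rankOne_rate_alias (hN : 1 ≤ N) (hR : 1 ≤ R) (a : ℝ) (ha : 0 < a) {s q q' : Fin d → ℝ}
    (hs : ∀ ν, |s ν| ≤ Real.pi) (ν₀ : Fin d) (hν₀ : s ν₀ ≠ 0) (μ ν : Fin d)
    (hq : ∀ κ, |q κ| ≤ Real.pi * N) (hrep : ∀ κ, ∃ m : ℤ, q κ = s κ + 2 * Real.pi * m)
    (hq' : ∀ κ, |q' κ| ≤ Real.pi * N) (hrep' : ∀ κ, ∃ m : ℤ, q' κ = s κ + 2 * Real.pi * m) :
    ‖((cB N a s : ℝ) : ℂ) * bR N a μ q s * conj (bR N a ν q' s)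
        - ((cB (R * N) a s : ℝ) : ℂ) * bR (R * N) a μ q s * conj (bR (R * N) a ν q' s)‖
      ≤ (4 * d * Cphi / T4GaugeActionRate.gam0 d ^ 2 * ((N : ℝ) ^ 2)⁻¹
            + (Ab d * ((∑ κ, |q κ|) / N) + Bb d * ((N : ℝ) ^ 2)⁻¹)
            + (Ab d * ((∑ κ, |q' κ|) / N) + Bb d * ((N : ℝ) ^ 2)⁻¹))
          * ((4 * d + a) / a * bMajA d s q μ * bMajA d s q' ν) := by
  have hRN := one_le_RN hN hR
  have hqRN : ∀ κ, |q κ| ≤ Real.pi * (R * N : ℕ) := fun κ => zone_RN hR (hq κ)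
  have hqRN' : ∀ κ, |q' κ| ≤ Real.pi * (R * N : ℕ) := fun κ => zone_RN hR (hq' κ)
  have hg := T4GaugeActionRate.gam0_pos d
  have hCφ := B5ActionRate166.Cphi_pos
  have hCψ := B5ActionRate166.Cpsi_pos
  have hAb : 0 ≤ Ab d := by unfold Ab; positivity
  have hBb : 0 ≤ Bb d := by unfold Bb; positivity
  exact rankOne_rate_of hN hR a ha hs ν₀ hν₀
    (norm_bR_le_alias hN a ha hs ν₀ hν₀ hq hrep μ) (norm_bR_le_alias hRN a ha hs ν₀ hν₀ hqRN hrep μ)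
    (norm_bR_le_alias hRN a ha hs ν₀ hν₀ hqRN' hrep' ν)
    (bR_rate_alias hN hR a ha μ hs ν₀ hν₀ hq hrep) (bR_rate_alias hN hR a ha ν hs ν₀ hν₀ hq' hrep')
    (by positivity)

/-! ### zone-centre (`l = 0`) rates — second order, currency `N⁻²` -/

omit [NeZero N] [NeZero R] in
/-- two real factors: `|xy − x′y′| ≤ r_x·Y + X·r_y` from `|x′| ≤ X`, `|y| ≤ Y`. [folklore] -/
theorem rate_mul_real {x x' y y' X Y rx ry : ℝ} (hx' : |x'| ≤ X) (hy : |y| ≤ Y) (hxx : |x - x'| ≤ rx)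
    (hyy : |y - y'| ≤ ry) : |x * y - x' * y'| ≤ rx * Y + X * ry := by
  have e : x * y - x' * y' = (x - x') * y + x' * (y - y') := by ring
  rw [e]
  refine (abs_add_le _ _).trans ?_
  rw [abs_mul, abs_mul]
  exact add_le_add (mul_le_mul hxx hy (abs_nonneg _) ((abs_nonneg _).trans hxx))
    (mul_le_mul hx' hyy (abs_nonneg _) ((abs_nonneg _).trans hx'))

omit [NeZero N] [NeZero R] in
/-- `|p′_ν| ≤ π ≤ πN`. [folklore] -/
theorem zone_of_centre (hN : 1 ≤ N) {s : Fin d → ℝ} (hs : ∀ ν, |s ν| ≤ Real.pi) (ν : Fin d) :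
    |s ν| ≤ Real.pi * N := by
  have : (1 : ℝ) ≤ N := by exact_mod_cast hN
  nlinarith [hs ν, abs_nonneg (s ν), Real.pi_pos]

/-- the `l = 0` term is a product of three `[0,1]`-valued resp. `|p′|⁻²`-bounded factors:
`T0 = |u(p′)|²·|v_μ(p′)|²·Δ(p′)⁻¹`. [folklore] -/
theorem T0_eq (μ : Fin d) (s : Fin d → ℝ) :
    T0 N μ s = Ur N (fun _ => 0) s * uFactorr N 0 (s μ) * (DeltaXir N 0 s)⁻¹ := by
  unfold T0; ring

/-- **η-RATE OF THE `l = 0` TERM `T0`** (second order at the zone centre): `|T0^{(N)} − T0^{(RN)}|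
≤ (π⁶/384 + π²/24)·N⁻²` (`|u|²`, `|v_μ|²` move by `(π⁴/192)|p′|²N⁻²`, `Δ⁻¹` by `(π²/24)N⁻²`, and
`Δ(p′) ≥ (4/π²)|p′|²`). [cite: King1986, (4.31) p.673] [folklore] -/
theorem T0_rate (hN : 1 ≤ N) (hR : 1 ≤ R) (μ : Fin d) {s : Fin d → ℝ} (hs : ∀ ν, |s ν| ≤ Real.pi)
    (ν₀ : Fin d) (hν₀ : s ν₀ ≠ 0) :
    |T0 N μ s - T0 (R * N) μ s| ≤ (Real.pi ^ 6 / 384 + Real.pi ^ 2 / 24) * ((N : ℝ) ^ 2)⁻¹ := by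
  have hRN := one_le_RN hN hR
  have hπ := Real.pi_pos
  have hsN : ∀ ν, |s ν| ≤ Real.pi * N := zone_of_centre hN hs
  have hm0 : 0 < momSq s := momSq_pos_of_rep hs ν₀ hν₀ fun ν => ⟨0, by simp⟩
  set ν2 := ((N : ℝ) ^ 2)⁻¹ with hν2
  have hν20 : 0 ≤ ν2 := by positivity
  have hA' : |Ur (R * N) (fun _ => 0) s| ≤ 1 := by
    rw [abs_of_nonneg (Ur_nonneg _ _ _)]; exact Ur_le_one _ hRN _ _
  have hB : |uFactorr N 0 (s μ)| ≤ 1 := by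
    rw [abs_of_nonneg (uFactorr_nonneg _ _ _)]; exact uFactorr_le_one _ hN _ _
  have hB' : |uFactorr (R * N) 0 (s μ)| ≤ 1 := by
    rw [abs_of_nonneg (uFactorr_nonneg _ _ _)]; exact uFactorr_le_one _ hRN _ _
  have hDN : 4 / Real.pi ^ 2 * momSq s ≤ DeltaXir N 0 s := DeltaXir_ge_momSq hN hsN
  have hDpos : 0 < DeltaXir N 0 s := lt_of_lt_of_le (by positivity) hDN
  have hC : |(DeltaXir N 0 s)⁻¹| ≤ Real.pi ^ 2 / 4 / momSq s := by
    rw [abs_of_pos (inv_pos.mpr hDpos)]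
    calc (DeltaXir N 0 s)⁻¹ ≤ (4 / Real.pi ^ 2 * momSq s)⁻¹ := inv_anti₀ (by positivity) hDN
      _ = Real.pi ^ 2 / 4 / momSq s := by field_simp
  have rA : |Ur N (fun _ => 0) s - Ur (R * N) (fun _ => 0) s| ≤ Real.pi ^ 4 / 192 * momSq s * ν2 :=
    Ur_zero_rate hN hR hs
  have rB : |uFactorr N 0 (s μ) - uFactorr (R * N) 0 (s μ)| ≤ Real.pi ^ 4 / 192 * momSq s * ν2 := by
    refine (uFactorr_zero_rate hN hR (hs μ)).trans ?_
    gcongr; exact sq_le_momSq s μ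
  have rC : |(DeltaXir N 0 s)⁻¹ - (DeltaXir (R * N) 0 s)⁻¹| ≤ Real.pi ^ 2 / 24 * ν2 :=
    inv_DeltaXir_sub_abs hN hR hsN hm0
  have s1 := rate_mul_real hA' hB rA rB
  have hAB' : |Ur (R * N) (fun _ => 0) s * uFactorr (R * N) 0 (s μ)| ≤ 1 := by
    rw [abs_mul]; nlinarith [abs_nonneg (Ur (R * N) (fun _ => 0) s), abs_nonneg (uFactorr (R * N) 0 (s μ))]
  have s2 := rate_mul_real hAB' hC s1 rC
  rw [T0_eq, T0_eq]
  refine s2.trans (le_of_eq ?_)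
  field_simp
  ring

/-- `S₁ = φ₁₆₂ − T0` (the printed sum (1.62) minus its `l = 0` term). [folklore] -/
theorem S1x_eq_phi162_sub (hN : 1 ≤ N) (μ : Fin d) {s : Fin d → ℝ} (hs : ∀ ν, |s ν| ≤ Real.pi) :
    S1x N μ s = phi162 N μ s - T0 N μ s := by
  have h1 := phiMu_eq_T0_S1x (n := N) 1 μ s
  have h2 := B5Bounds167Lattice.phiMu_eq_one_add N hN 1 μ s hs
  linarith

/-- the constant of the `S₁` rate: `C_φ + π⁶/384 + π²/24`. [folklore] -/
def CS1 : ℝ := Cphi + Real.pi ^ 6 / 384 + Real.pi ^ 2 / 24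

omit [NeZero N] [NeZero R] in
/-- `CS1 > 0`. [folklore] -/
theorem CS1_pos : 0 < CS1 := by unfold CS1; have := B5ActionRate166.Cphi_pos; positivity

/-- **η-RATE OF `S₁ = Σ_{l≠0}|ux_μ|²Δ⁻¹`** (second order): `|S₁^{(N)} − S₁^{(RN)}| ≤ CS1·N⁻²` (the printed
(1.62)-rate `C_φN⁻²` of `B5ActionRate166.phi162_rate` minus the `l = 0` term's). [folklore] -/
theorem S1x_rate (hN : 1 ≤ N) (hR : 1 ≤ R) (μ : Fin d) {s : Fin d → ℝ} (hs : ∀ ν, |s ν| ≤ Real.pi)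
    (ν₀ : Fin d) (hν₀ : s ν₀ ≠ 0) : |S1x N μ s - S1x (R * N) μ s| ≤ CS1 * ((N : ℝ) ^ 2)⁻¹ := by
  have hRN := one_le_RN hN hR
  rw [S1x_eq_phi162_sub hN μ hs, S1x_eq_phi162_sub hRN μ hs]
  have h1 := B5ActionRate166.phi162_rate hN hR μ s hs ν₀ hν₀
  rw [abs_sub_comm] at h1
  have h2 := T0_rate hN hR μ hs ν₀ hν₀
  have e : phi162 N μ s - T0 N μ s - (phi162 (R * N) μ s - T0 (R * N) μ s)
      = (phi162 N μ s - phi162 (R * N) μ s) - (T0 N μ s - T0 (R * N) μ s) := by ring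
  rw [e]
  refine (abs_sub _ _).trans ?_
  unfold CS1
  linarith

/-- `dZ` as a product of three bounded factors: `(1 + aS₁)·(Δ₀φ_μ)⁻¹·(Δ₀/Δ(p′))`. [folklore] -/
theorem dZ_eq_three (hN : 1 ≤ N) (a : ℝ) (ha : 0 < a) (μ : Fin d) {s : Fin d → ℝ}
    (hs : ∀ ν, |s ν| ≤ Real.pi) (ν₀ : Fin d) (hν₀ : s ν₀ ≠ 0) :
    dZ N a μ s = (1 + a * S1x N μ s) * (Delta1r 0 s * phiMu N a μ s)⁻¹
      * (Delta1r 0 s * (DeltaXir N 0 s)⁻¹) := by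
  have hΔ := (Delta1r_pos s hs ν₀ hν₀).ne'
  have hφ := (B5QGQ199Rate.phiMu_pos N a ha.le μ s).ne'
  have hD : DeltaXir N 0 s ≠ 0 :=
    ((Delta1r_pos s hs ν₀ hν₀).trans_le (Delta1r_le_DeltaXir N hN s)).ne'
  unfold dZ
  field_simp

/-- **η-RATE OF THE COMBINED ZONE-CENTRE DIAGONAL `dZ`** ((1.87); second order):
`|dZ^{(N)} − dZ^{(RN)}| ≤ (CS1/γ₀ + (1 + a/4)·Δ₀·(C_φ/(aγ₀²) + π²/(24aγ₀)))·N⁻²` with `Δ₀ ≤ 4d`.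
[cite: Balaban1984PropagatorsI, (1.87) p.32] [folklore] -/
theorem dZ_rate (hN : 1 ≤ N) (hR : 1 ≤ R) (a : ℝ) (ha : 0 < a) (μ : Fin d) {s : Fin d → ℝ}
    (hs : ∀ ν, |s ν| ≤ Real.pi) (ν₀ : Fin d) (hν₀ : s ν₀ ≠ 0) :
    |dZ N a μ s - dZ (R * N) a μ s|
      ≤ (CS1 / T4GaugeActionRate.gam0 d + (1 + a / 4) * Delta1r 0 s
            * (Cphi / (a * T4GaugeActionRate.gam0 d ^ 2) + Real.pi ^ 2 / 24 / (a * T4GaugeActionRate.gam0 d)))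
          * ((N : ℝ) ^ 2)⁻¹ := by
  have hRN := one_le_RN hN hR
  have hπ := Real.pi_pos
  have hg := T4GaugeActionRate.gam0_pos d
  have hΔ := Delta1r_pos s hs ν₀ hν₀
  have hsN : ∀ ν, |s ν| ≤ Real.pi * N := zone_of_centre hN hs
  have hm0 : 0 < momSq s := momSq_pos_of_rep hs ν₀ hν₀ fun ν => ⟨0, by simp⟩
  -- factor 1
  have h1' : |1 + a * S1x (R * N) μ s| ≤ 1 + a / 4 := by
    have := S1x_le hRN μ s hs; have := S1x_nonneg (n := R * N) μ s
    rw [abs_of_nonneg (by positivity)]; nlinarith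
  have r1 : |(1 + a * S1x N μ s) - (1 + a * S1x (R * N) μ s)| ≤ a * (CS1 * ((N : ℝ) ^ 2)⁻¹) := by
    have := S1x_rate hN hR μ hs ν₀ hν₀
    rw [show (1 + a * S1x N μ s) - (1 + a * S1x (R * N) μ s) = a * (S1x N μ s - S1x (R * N) μ s) by ring,
      abs_mul, abs_of_pos ha]
    exact mul_le_mul_of_nonneg_left this ha.le
  -- factor 2
  obtain ⟨h2p, h2le⟩ := inv_D0phi_bounds hN a ha μ hs ν₀ hν₀
  obtain ⟨h2p', h2le'⟩ := inv_D0phi_bounds hRN a ha μ hs ν₀ hν₀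
  have h2 : |(Delta1r 0 s * phiMu N a μ s)⁻¹| ≤ 1 / (a * T4GaugeActionRate.gam0 d) := by
    rwa [abs_of_pos h2p]
  have h2' : |(Delta1r 0 s * phiMu (R * N) a μ s)⁻¹| ≤ 1 / (a * T4GaugeActionRate.gam0 d) := by
    rwa [abs_of_pos h2p']
  have r2 := inv_D0phi_rate hN hR a ha μ hs ν₀ hν₀
  -- factor 3
  have hDN : 0 < DeltaXir N 0 s := hΔ.trans_le (Delta1r_le_DeltaXir N hN s)
  have h3 : |Delta1r 0 s * (DeltaXir N 0 s)⁻¹| ≤ 1 := by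
    rw [abs_of_pos (by positivity), ← div_eq_mul_inv, div_le_one hDN]
    exact Delta1r_le_DeltaXir N hN s
  have r3 : |Delta1r 0 s * (DeltaXir N 0 s)⁻¹ - Delta1r 0 s * (DeltaXir (R * N) 0 s)⁻¹|
      ≤ Delta1r 0 s * (Real.pi ^ 2 / 24 * ((N : ℝ) ^ 2)⁻¹) := by
    rw [← mul_sub, abs_mul, abs_of_pos hΔ]
    exact mul_le_mul_of_nonneg_left (inv_DeltaXir_sub_abs hN hR hsN hm0) hΔ.le
  -- combine
  have s1 := rate_mul_real h1' h2 r1 r2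
  have h12' : |(1 + a * S1x (R * N) μ s) * (Delta1r 0 s * phiMu (R * N) a μ s)⁻¹|
      ≤ (1 + a / 4) * (1 / (a * T4GaugeActionRate.gam0 d)) := by
    rw [abs_mul]; exact mul_le_mul h1' h2' (abs_nonneg _) (by positivity)
  have s2 := rate_mul_real h12' h3 s1 r3
  rw [dZ_eq_three hN a ha μ hs ν₀ hν₀, dZ_eq_three hRN a ha μ hs ν₀ hν₀]
  refine s2.trans (le_of_eq ?_)
  field_simp
  ring

/-- **η-RATE OF THE (0,0) x-BLOCK ENTRY**, i.e. of the printed (1.87) regrouping: an `O(N⁻²)` bound with a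
constant depending on `d, a` only (`Δ₀ ≤ 4d`). [cite: Balaban1984PropagatorsI, (1.87) p.32] [folklore] -/
theorem dZ_rate' (hN : 1 ≤ N) (hR : 1 ≤ R) (a : ℝ) (ha : 0 < a) (μ : Fin d) {s : Fin d → ℝ}
    (hs : ∀ ν, |s ν| ≤ Real.pi) (ν₀ : Fin d) (hν₀ : s ν₀ ≠ 0) :
    |dZ N a μ s - dZ (R * N) a μ s|
      ≤ (CS1 / T4GaugeActionRate.gam0 d + (1 + a / 4) * (4 * d)
            * (Cphi / (a * T4GaugeActionRate.gam0 d ^ 2) + Real.pi ^ 2 / 24 / (a * T4GaugeActionRate.gam0 d)))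
          * ((N : ℝ) ^ 2)⁻¹ := by
  refine (dZ_rate hN hR a ha μ hs ν₀ hν₀).trans ?_
  have hg := T4GaugeActionRate.gam0_pos d
  have hC := B5ActionRate166.Cphi_pos
  have h4 := Delta1r_le s
  have := CS1_pos
  gcongr

/-! ### the zone-centre bracket (1.88): rates of `Δ(p′)S₂`, `BrP`, `rS` and `bR(p′)` — second order -/

omit [NeZero N] [NeZero R] in
/-- `(4/π²)|p′|² ≤ Δ₀(p′)` (Jordan, `B4Strip.S1r_ge`). [folklore] -/
theorem Delta1r_ge_momSq {s : Fin d → ℝ} (hs : ∀ ν, |s ν| ≤ Real.pi) :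
    4 / Real.pi ^ 2 * momSq s ≤ Delta1r 0 s := by
  unfold Delta1r King1986.momSq
  rw [add_zero, Finset.mul_sum]
  exact Finset.sum_le_sum fun ν _ => by
    have := S1r_ge (s ν) (hs ν)
    calc 4 / Real.pi ^ 2 * s ν ^ 2 = 4 * s ν ^ 2 / Real.pi ^ 2 := by ring
      _ ≤ S1r (s ν) := this

omit [NeZero N] [NeZero R] in
/-- `|p′|² ≤ (π²/4)Δ₀(p′)`. [folklore] -/
theorem momSq_le_Delta1r {s : Fin d → ℝ} (hs : ∀ ν, |s ν| ≤ Real.pi) :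
    momSq s ≤ Real.pi ^ 2 / 4 * Delta1r 0 s := by
  have h := Delta1r_ge_momSq hs
  have hπ : 0 < Real.pi ^ 2 := by positivity
  calc momSq s = Real.pi ^ 2 / 4 * (4 / Real.pi ^ 2 * momSq s) := by field_simp
    _ ≤ Real.pi ^ 2 / 4 * Delta1r 0 s := by gcongr

omit [NeZero N] [NeZero R] in
/-- `Σ_ν x_ν⁴ ≤ (Σ_ν x_ν²)²`. [folklore] -/
theorem sum_pow_four_le (s : Fin d → ℝ) : ∑ ν, s ν ^ 4 ≤ momSq s ^ 2 := by
  unfold King1986.momSq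
  rw [sq, Finset.sum_mul]
  refine Finset.sum_le_sum fun ν _ => ?_
  have h1 : s ν ^ 2 ≤ ∑ κ, s κ ^ 2 :=
    Finset.single_le_sum (f := fun κ => s κ ^ 2) (fun _ _ => sq_nonneg _) (Finset.mem_univ ν)
  calc s ν ^ 4 = s ν ^ 2 * s ν ^ 2 := by ring
    _ ≤ s ν ^ 2 * ∑ κ, s κ ^ 2 := mul_le_mul_of_nonneg_left h1 (sq_nonneg _)

omit [NeZero N] [NeZero R] in
/-- **second-order rate of `Δ(p′)` at the zone centre**: `|Δ^{(N)}(p′) − Δ^{(RN)}(p′)| ≤ |p′|⁴/(12N²)`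
(coordinatewise §1). [cite: King1986, (4.10) p.671] [folklore] -/
theorem DeltaXir_centre_rate (hN : 1 ≤ N) (hR : 1 ≤ R) {s : Fin d → ℝ} (hs : ∀ ν, |s ν| ≤ Real.pi) :
    |DeltaXir N 0 s - DeltaXir (R * N) 0 s| ≤ momSq s ^ 2 / (12 * (N : ℝ) ^ 2) := by
  have hsN := zone_of_centre hN hs
  unfold DeltaXir
  rw [add_zero, add_zero, ← Finset.sum_sub_distrib]
  refine (Finset.abs_sum_le_sum_abs _ _).trans ?_
  calc ∑ ν, |Sxir N (s ν) - Sxir (R * N) (s ν)| ≤ ∑ ν, s ν ^ 4 / (12 * (N : ℝ) ^ 2) :=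
        Finset.sum_le_sum fun ν _ => Sxir_sub_le_quartic hN hR (hsN ν)
    _ = (∑ ν, s ν ^ 4) / (12 * (N : ℝ) ^ 2) := by rw [Finset.sum_div]
    _ ≤ momSq s ^ 2 / (12 * (N : ℝ) ^ 2) := by
        gcongr; exact sum_pow_four_le s

omit [NeZero R] in
/-- `Δ(p′)S₂ = Δ(p′)ψ − |u(p′)|²/Δ(p′)`. [folklore] -/
theorem DS2x_eq (hN : 1 ≤ N) {s : Fin d → ℝ} (hs : ∀ ν, |s ν| ≤ Real.pi) (ν₀ : Fin d) (hν₀ : s ν₀ ≠ 0) :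
    DeltaXir N 0 s * S2x N s
      = DeltaXir N 0 s * psiSum N s - Ur N (fun _ => 0) s * (DeltaXir N 0 s)⁻¹ := by
  have hD : DeltaXir N 0 s ≠ 0 := (DeltaXir_pos N hN s hs ν₀ hν₀).ne'
  rw [psiSum_eq_S2x (n := N) s]
  field_simp
  ring

omit [NeZero R] in
/-- `0 ≤ Δ(p′)S₂ ≤ π²d/16`. [folklore] -/
theorem DS2x_bounds (hN : 1 ≤ N) {s : Fin d → ℝ} (hs : ∀ ν, |s ν| ≤ Real.pi) :
    0 ≤ DeltaXir N 0 s * S2x N s ∧ DeltaXir N 0 s * S2x N s ≤ Real.pi ^ 2 * d / 16 := by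
  have h2 := S2x_le hN s hs
  have h2' := S2x_nonneg (n := N) s
  have hD := DeltaXir_le_Delta1r N s hs
  have hD' := DeltaXir_nonneg N 0 le_rfl s
  have h4 := Delta1r_le s
  have hπ : 0 ≤ Real.pi ^ 2 := sq_nonneg _
  have hΔd : DeltaXir N 0 s ≤ Real.pi ^ 2 * d := hD.trans (by nlinarith [hπ])
  refine ⟨mul_nonneg hD' h2', ?_⟩
  calc DeltaXir N 0 s * S2x N s ≤ Real.pi ^ 2 * d * (1 / 16) := mul_le_mul hΔd h2 h2' (by positivity)
    _ = Real.pi ^ 2 * d / 16 := by ring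

/-- the constant of the `Δ(p′)S₂` rate: `π⁴/192 + (π²/4)C_ψ + π⁶/768 + π²/24`. [folklore] -/
def CW : ℝ := Real.pi ^ 4 / 192 + Real.pi ^ 2 / 4 * Cpsi + Real.pi ^ 6 / 768 + Real.pi ^ 2 / 24

omit [NeZero N] [NeZero R] in
/-- `CW > 0`. [folklore] -/
theorem CW_pos : 0 < CW := by unfold CW; have := B5ActionRate166.Cpsi_pos; positivity

/-- **η-RATE OF `Δ(p′)S₂`** (the inequality announced as missing in v1; second order at the centre):
`|Δ^{(N)}S₂^{(N)} − Δ^{(RN)}S₂^{(RN)}| ≤ CW·N⁻²` — `Δψ` through `DeltaXir_centre_rate`, `ψ ≤ Δ₀⁻²`,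
`|p′|² ≤ (π²/4)Δ₀` and the printed (1.63)-rate `B5ActionRate166.Psi_rate`; `|u(p′)|²/Δ(p′)` as in `T0_rate`.
[folklore] -/
theorem DS2x_rate (hN : 1 ≤ N) (hR : 1 ≤ R) {s : Fin d → ℝ} (hs : ∀ ν, |s ν| ≤ Real.pi) (ν₀ : Fin d)
    (hν₀ : s ν₀ ≠ 0) :
    |DeltaXir N 0 s * S2x N s - DeltaXir (R * N) 0 s * S2x (R * N) s| ≤ CW * ((N : ℝ) ^ 2)⁻¹ := by
  have hRN := one_le_RN hN hR
  have hπ := Real.pi_pos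
  have hsN := zone_of_centre hN hs
  have hm0 : 0 < momSq s := momSq_pos_of_rep hs ν₀ hν₀ fun ν => ⟨0, by simp⟩
  have hΔ := Delta1r_pos s hs ν₀ hν₀
  have hC := B5ActionRate166.Cpsi_pos
  have hDN : 0 < DeltaXir N 0 s := DeltaXir_pos N hN s hs ν₀ hν₀
  have hDRN : 0 < DeltaXir (R * N) 0 s := DeltaXir_pos (R * N) hRN s hs ν₀ hν₀
  have hN2 : 0 < ((N : ℝ) ^ 2)⁻¹ := by
    have : (0 : ℝ) < N := by exact_mod_cast hN
    positivity
  -- piece 1 : Δψ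
  have hψ0 : 0 < psiSum N s := psiSum_pos hN s hs ν₀ hν₀
  have hψle : psiSum N s ≤ (Delta1r 0 s ^ 2)⁻¹ := B5ActionRate166.psiSum_le N hN s hs ν₀ hν₀
  have hx' : |DeltaXir (R * N) 0 s| ≤ DeltaXir (R * N) 0 s := (abs_of_pos hDRN).le
  have hy : |psiSum N s| ≤ (Delta1r 0 s ^ 2)⁻¹ := by rwa [abs_of_pos hψ0]
  have rx := DeltaXir_centre_rate hN hR hs
  have key : Delta1r 0 s * |psiSum N s - psiSum (R * N) s| ≤ Cpsi * ((N : ℝ) ^ 2)⁻¹ := by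
    have h := B5ActionRate166.Psi_rate hN hR s hs ν₀ hν₀
    rw [← mul_sub, abs_mul, abs_of_pos (by positivity), abs_sub_comm] at h
    nlinarith [abs_nonneg (psiSum N s - psiSum (R * N) s)]
  have ry : |psiSum N s - psiSum (R * N) s| ≤ Cpsi * ((N : ℝ) ^ 2)⁻¹ / Delta1r 0 s := by
    rw [le_div_iff₀ hΔ, mul_comm]; exact key
  have s1 := rate_mul_real hx' hy rx ry
  have hmz := momSq_le_Delta1r hs
  have hq : momSq s / Delta1r 0 s ≤ Real.pi ^ 2 / 4 := by rw [div_le_iff₀ hΔ]; exact hmz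
  have t1 : momSq s ^ 2 / (12 * (N : ℝ) ^ 2) * (Delta1r 0 s ^ 2)⁻¹
      ≤ Real.pi ^ 4 / 192 * ((N : ℝ) ^ 2)⁻¹ := by
    have hq0 : 0 ≤ momSq s / Delta1r 0 s := by positivity
    calc momSq s ^ 2 / (12 * (N : ℝ) ^ 2) * (Delta1r 0 s ^ 2)⁻¹
        = (momSq s / Delta1r 0 s) ^ 2 / 12 * ((N : ℝ) ^ 2)⁻¹ := by field_simp
      _ ≤ (Real.pi ^ 2 / 4) ^ 2 / 12 * ((N : ℝ) ^ 2)⁻¹ := by gcongr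
      _ = Real.pi ^ 4 / 192 * ((N : ℝ) ^ 2)⁻¹ := by ring
  have t2 : DeltaXir (R * N) 0 s * (Cpsi * ((N : ℝ) ^ 2)⁻¹ / Delta1r 0 s)
      ≤ Real.pi ^ 2 / 4 * Cpsi * ((N : ℝ) ^ 2)⁻¹ := by
    have hle := DeltaXir_le_Delta1r (R * N) s hs
    calc DeltaXir (R * N) 0 s * (Cpsi * ((N : ℝ) ^ 2)⁻¹ / Delta1r 0 s)
        ≤ (Real.pi ^ 2 / 4 * Delta1r 0 s) * (Cpsi * ((N : ℝ) ^ 2)⁻¹ / Delta1r 0 s) :=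
          mul_le_mul_of_nonneg_right hle (by positivity)
      _ = Real.pi ^ 2 / 4 * Cpsi * ((N : ℝ) ^ 2)⁻¹ := by field_simp
  -- piece 2 : |u(p′)|²/Δ(p′)
  have hA' : |Ur (R * N) (fun _ => 0) s| ≤ 1 := by
    rw [abs_of_nonneg (Ur_nonneg _ _ _)]; exact Ur_le_one _ hRN _ _
  have hDNj : 4 / Real.pi ^ 2 * momSq s ≤ DeltaXir N 0 s := DeltaXir_ge_momSq hN hsN
  have hCi : |(DeltaXir N 0 s)⁻¹| ≤ Real.pi ^ 2 / 4 / momSq s := by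
    rw [abs_of_pos (inv_pos.mpr hDN)]
    calc (DeltaXir N 0 s)⁻¹ ≤ (4 / Real.pi ^ 2 * momSq s)⁻¹ := inv_anti₀ (by positivity) hDNj
      _ = Real.pi ^ 2 / 4 / momSq s := by field_simp
  have rA : |Ur N (fun _ => 0) s - Ur (R * N) (fun _ => 0) s|
      ≤ Real.pi ^ 4 / 192 * momSq s * ((N : ℝ) ^ 2)⁻¹ := Ur_zero_rate hN hR hs
  have rC : |(DeltaXir N 0 s)⁻¹ - (DeltaXir (R * N) 0 s)⁻¹| ≤ Real.pi ^ 2 / 24 * ((N : ℝ) ^ 2)⁻¹ :=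
    inv_DeltaXir_sub_abs hN hR hsN hm0
  have s2 := rate_mul_real hA' hCi rA rC
  have t3 : Real.pi ^ 4 / 192 * momSq s * ((N : ℝ) ^ 2)⁻¹ * (Real.pi ^ 2 / 4 / momSq s)
        + 1 * (Real.pi ^ 2 / 24 * ((N : ℝ) ^ 2)⁻¹)
      = (Real.pi ^ 6 / 768 + Real.pi ^ 2 / 24) * ((N : ℝ) ^ 2)⁻¹ := by
    field_simp
    ring
  -- combine
  rw [DS2x_eq hN hs ν₀ hν₀, DS2x_eq hRN hs ν₀ hν₀]
  have e : DeltaXir N 0 s * psiSum N s - Ur N (fun _ => 0) s * (DeltaXir N 0 s)⁻¹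
        - (DeltaXir (R * N) 0 s * psiSum (R * N) s - Ur (R * N) (fun _ => 0) s * (DeltaXir (R * N) 0 s)⁻¹)
      = (DeltaXir N 0 s * psiSum N s - DeltaXir (R * N) 0 s * psiSum (R * N) s)
        - (Ur N (fun _ => 0) s * (DeltaXir N 0 s)⁻¹ - Ur (R * N) (fun _ => 0) s * (DeltaXir (R * N) 0 s)⁻¹) := by
    ring
  rw [e]
  refine (abs_sub _ _).trans ?_
  calc |DeltaXir N 0 s * psiSum N s - DeltaXir (R * N) 0 s * psiSum (R * N) s|
        + |Ur N (fun _ => 0) s * (DeltaXir N 0 s)⁻¹ - Ur (R * N) (fun _ => 0) s * (DeltaXir (R * N) 0 s)⁻¹|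
      ≤ (Real.pi ^ 4 / 192 * ((N : ℝ) ^ 2)⁻¹ + Real.pi ^ 2 / 4 * Cpsi * ((N : ℝ) ^ 2)⁻¹)
        + (Real.pi ^ 6 / 768 + Real.pi ^ 2 / 24) * ((N : ℝ) ^ 2)⁻¹ :=
        add_le_add (s1.trans (add_le_add t1 t2)) (s2.trans t3.le)
    _ = CW * ((N : ℝ) ^ 2)⁻¹ := by unfold CW; ring

/-- the majorant of the curly bracket `BrP` and of `rS`: `MBr = 1 + a/4 + aπ²d/16`, `MrS = MBr/(aγ₀²)`. [folklore] -/
def MBr (d : ℕ) (a : ℝ) : ℝ := 1 + a / 4 + a * (Real.pi ^ 2 * d / 16)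

/-- the majorant of `rS`: `(1 + a/4 + aπ²d/16)/(aγ₀²)`. [folklore] -/
def MrS (d : ℕ) (a : ℝ) : ℝ := (1 + a / 4 + a * (Real.pi ^ 2 * d / 16)) / (a * T4GaugeActionRate.gam0 d ^ 2)

omit [NeZero N] [NeZero R] in
/-- `MrS > 0`. [folklore] -/
theorem MrS_pos (d : ℕ) {a : ℝ} (ha : 0 < a) : 0 < MrS d a := by
  unfold MrS; have := T4GaugeActionRate.gam0_pos d; positivity

/-- the constant of the `BrP` rate (per unit `a`): `CS1 + π⁸d/3072 + CW`. [folklore] -/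
def CBr (d : ℕ) : ℝ := CS1 + Real.pi ^ 8 * d / 3072 + CW

omit [NeZero N] [NeZero R] in
/-- `CBr > 0`. [folklore] -/
theorem CBr_pos (d : ℕ) : 0 < CBr d := by
  unfold CBr; have := CS1_pos; have := CW_pos; positivity

/-- **η-RATE OF THE CURLY BRACKET `BrP`** of (1.88) at `l = 0`: `|BrP^{(N)} − BrP^{(RN)}| ≤ a·CBr·N⁻²`.
[cite: Balaban1984PropagatorsI, (1.88) p.32] [folklore] -/
theorem BrP_rate (hN : 1 ≤ N) (hR : 1 ≤ R) (a : ℝ) (ha : 0 < a) (μ : Fin d) {s : Fin d → ℝ}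
    (hs : ∀ ν, |s ν| ≤ Real.pi) (ν₀ : Fin d) (hν₀ : s ν₀ ≠ 0) :
    |BrP N a μ s - BrP (R * N) a μ s| ≤ a * CBr d * ((N : ℝ) ^ 2)⁻¹ := by
  have hRN := one_le_RN hN hR
  have hπ := Real.pi_pos
  have r1 := S1x_rate hN hR μ hs ν₀ hν₀
  have hx' : |uFactorr (R * N) 0 (s μ)| ≤ 1 := by
    rw [abs_of_nonneg (uFactorr_nonneg _ _ _)]; exact uFactorr_le_one _ hRN _ _
  obtain ⟨hW0, hW1⟩ := DS2x_bounds hN hs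
  have hy : |DeltaXir N 0 s * S2x N s| ≤ Real.pi ^ 2 * d / 16 := by rwa [abs_of_nonneg hW0]
  have rx : |uFactorr N 0 (s μ) - uFactorr (R * N) 0 (s μ)| ≤ Real.pi ^ 6 / 192 * ((N : ℝ) ^ 2)⁻¹ := by
    refine (uFactorr_zero_rate hN hR (hs μ)).trans ?_
    have h2 : s μ ^ 2 ≤ Real.pi ^ 2 := by
      rw [← sq_abs]; exact pow_le_pow_left₀ (abs_nonneg _) (hs μ) 2
    calc Real.pi ^ 4 / 192 * s μ ^ 2 * ((N : ℝ) ^ 2)⁻¹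
        ≤ Real.pi ^ 4 / 192 * Real.pi ^ 2 * ((N : ℝ) ^ 2)⁻¹ := by gcongr
      _ = Real.pi ^ 6 / 192 * ((N : ℝ) ^ 2)⁻¹ := by ring
  have ry := DS2x_rate hN hR hs ν₀ hν₀
  have sP := rate_mul_real hx' hy rx ry
  have e : BrP N a μ s - BrP (R * N) a μ s
      = a * (S1x N μ s - S1x (R * N) μ s)
        - a * (uFactorr N 0 (s μ) * (DeltaXir N 0 s * S2x N s)
              - uFactorr (R * N) 0 (s μ) * (DeltaXir (R * N) 0 s * S2x (R * N) s)) := by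
    unfold BrP; ring
  rw [e]
  refine (abs_sub _ _).trans ?_
  rw [abs_mul, abs_mul, abs_of_pos ha]
  calc a * |S1x N μ s - S1x (R * N) μ s|
        + a * |uFactorr N 0 (s μ) * (DeltaXir N 0 s * S2x N s)
              - uFactorr (R * N) 0 (s μ) * (DeltaXir (R * N) 0 s * S2x (R * N) s)|
      ≤ a * (CS1 * ((N : ℝ) ^ 2)⁻¹)
        + a * (Real.pi ^ 6 / 192 * ((N : ℝ) ^ 2)⁻¹ * (Real.pi ^ 2 * d / 16) + 1 * (CW * ((N : ℝ) ^ 2)⁻¹)) := by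
        gcongr
    _ = a * CBr d * ((N : ℝ) ^ 2)⁻¹ := by unfold CBr; ring

omit [NeZero N] [NeZero R] in
/-- `0 ≤ Δ₀/Δ(p′) ≤ 1`. [folklore] -/
theorem ratio_bounds (hN : 1 ≤ N) {s : Fin d → ℝ} (hs : ∀ ν, |s ν| ≤ Real.pi) (ν₀ : Fin d) (hν₀ : s ν₀ ≠ 0) :
    0 ≤ Delta1r 0 s / DeltaXir N 0 s ∧ Delta1r 0 s / DeltaXir N 0 s ≤ 1 := by
  have hΔ := Delta1r_pos s hs ν₀ hν₀
  have hle := Delta1r_le_DeltaXir N hN s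
  have hD : 0 < DeltaXir N 0 s := hΔ.trans_le hle
  exact ⟨by positivity, (div_le_one hD).mpr hle⟩

omit [NeZero N] [NeZero R] in
/-- **η-RATE OF `(Δ₀/Δ(p′))²`**: `≤ Δ₀·(π²/12)·N⁻²`. [folklore] -/
theorem ratioSq_rate (hN : 1 ≤ N) (hR : 1 ≤ R) {s : Fin d → ℝ} (hs : ∀ ν, |s ν| ≤ Real.pi) (ν₀ : Fin d)
    (hν₀ : s ν₀ ≠ 0) :
    |(Delta1r 0 s / DeltaXir N 0 s) ^ 2 - (Delta1r 0 s / DeltaXir (R * N) 0 s) ^ 2|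
      ≤ Delta1r 0 s * (Real.pi ^ 2 / 12) * ((N : ℝ) ^ 2)⁻¹ := by
  have hRN := one_le_RN hN hR
  obtain ⟨a0, a1⟩ := ratio_bounds hN hs ν₀ hν₀
  obtain ⟨b0, b1⟩ := ratio_bounds hRN hs ν₀ hν₀
  have hΔ := Delta1r_pos s hs ν₀ hν₀
  have hsN := zone_of_centre hN hs
  have hm0 : 0 < momSq s := momSq_pos_of_rep hs ν₀ hν₀ fun ν => ⟨0, by simp⟩
  have r : |Delta1r 0 s / DeltaXir N 0 s - Delta1r 0 s / DeltaXir (R * N) 0 s|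
      ≤ Delta1r 0 s * (Real.pi ^ 2 / 24 * ((N : ℝ) ^ 2)⁻¹) := by
    rw [div_eq_mul_inv, div_eq_mul_inv, ← mul_sub, abs_mul, abs_of_pos hΔ]
    exact mul_le_mul_of_nonneg_left (inv_DeltaXir_sub_abs hN hR hsN hm0) hΔ.le
  have e : (Delta1r 0 s / DeltaXir N 0 s) ^ 2 - (Delta1r 0 s / DeltaXir (R * N) 0 s) ^ 2
      = (Delta1r 0 s / DeltaXir N 0 s + Delta1r 0 s / DeltaXir (R * N) 0 s)
        * (Delta1r 0 s / DeltaXir N 0 s - Delta1r 0 s / DeltaXir (R * N) 0 s) := by ring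
  rw [e, abs_mul]
  have hsum : |Delta1r 0 s / DeltaXir N 0 s + Delta1r 0 s / DeltaXir (R * N) 0 s| ≤ 2 := by
    rw [abs_of_nonneg (add_nonneg a0 b0)]; linarith
  calc |Delta1r 0 s / DeltaXir N 0 s + Delta1r 0 s / DeltaXir (R * N) 0 s|
        * |Delta1r 0 s / DeltaXir N 0 s - Delta1r 0 s / DeltaXir (R * N) 0 s|
      ≤ 2 * (Delta1r 0 s * (Real.pi ^ 2 / 24 * ((N : ℝ) ^ 2)⁻¹)) :=
        mul_le_mul hsum r (abs_nonneg _) (by norm_num)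
    _ = Delta1r 0 s * (Real.pi ^ 2 / 12) * ((N : ℝ) ^ 2)⁻¹ := by ring

/-- the constant of the `rS` rate, as a function of `Δ₀ = Δ₀(p′) ≤ 4d`:
`((Δ₀π²/(12γ₀) + 4dC_ψ/γ₀²)/(aγ₀) + Δ₀C_φ/(aγ₀³))·MBr + CBr/γ₀²`. [folklore] -/
def CrS (d : ℕ) (a Δ0 : ℝ) : ℝ :=
  ((Δ0 * (Real.pi ^ 2 / 12) / T4GaugeActionRate.gam0 d + 4 * d * Cpsi / T4GaugeActionRate.gam0 d ^ 2)
      / (a * T4GaugeActionRate.gam0 d)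
    + Δ0 * Cphi / (a * T4GaugeActionRate.gam0 d ^ 3)) * MBr d a
  + CBr d / T4GaugeActionRate.gam0 d ^ 2

omit [NeZero N] [NeZero R] in
/-- `CrS ≥ 0` and monotone in `Δ₀`. [folklore] -/
theorem CrS_nonneg_mono (d : ℕ) {a Δ0 Δ0' : ℝ} (ha : 0 < a) (h0 : 0 ≤ Δ0) (h : Δ0 ≤ Δ0') :
    0 ≤ CrS d a Δ0 ∧ CrS d a Δ0 ≤ CrS d a Δ0' := by
  have hg := T4GaugeActionRate.gam0_pos d
  have hC := B5ActionRate166.Cphi_pos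
  have hC' := B5ActionRate166.Cpsi_pos
  have hB := CBr_pos d
  have hπ := Real.pi_pos
  have hM : 0 < MBr d a := by unfold MBr; positivity
  unfold CrS
  refine ⟨by positivity, ?_⟩
  gcongr

/-- **η-RATE OF THE ZONE-CENTRE SCALAR `rS`** of (1.88): `|rS^{(N)} − rS^{(RN)}| ≤ CrS(d, a, Δ₀(p′))·N⁻²`
(`≤ CrS(d, a, 4d)·N⁻²` by `CrS_nonneg_mono` and `Delta1r_le`) — the four factors `(Δ₀/Δ)²`, `ψ₂⁻¹`,
`(Δ₀φ_μ)⁻¹`, `BrP` replaced one at a time. [cite: Balaban1984PropagatorsI, (1.88) p.32] [folklore] -/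
theorem rS_rate (hN : 1 ≤ N) (hR : 1 ≤ R) (a : ℝ) (ha : 0 < a) (μ : Fin d) {s : Fin d → ℝ}
    (hs : ∀ ν, |s ν| ≤ Real.pi) (ν₀ : Fin d) (hν₀ : s ν₀ ≠ 0) :
    |rS N a μ s - rS (R * N) a μ s| ≤ CrS d a (Delta1r 0 s) * ((N : ℝ) ^ 2)⁻¹ := by
  have hRN := one_le_RN hN hR
  have hπ := Real.pi_pos
  have hγ := T4GaugeActionRate.gam0_pos d
  have hΔ := Delta1r_pos s hs ν₀ hν₀
  have hN' : (N : ℝ) ≠ 0 := by have : (0 : ℝ) < N := (by exact_mod_cast hN); exact this.ne'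
  -- factor g = (Δ₀/Δ)²
  obtain ⟨g0, g1⟩ := ratio_sq_le_one hRN hs ν₀ hν₀
  have hg' : |(Delta1r 0 s / DeltaXir (R * N) 0 s) ^ 2| ≤ 1 := by rwa [abs_of_nonneg g0]
  have rg := ratioSq_rate hN hR hs ν₀ hν₀
  -- factor h = ψ₂⁻¹
  have hψN := T4GaugeActionRate.psi163_lower N hN s hs ν₀ hν₀
  have hψRN := T4GaugeActionRate.psi163_lower (R * N) hRN s hs ν₀ hν₀
  have hh : |(T4GaugeActionRate.psi163 N s)⁻¹| ≤ (T4GaugeActionRate.gam0 d)⁻¹ := by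
    rw [abs_of_pos (inv_pos.mpr (hγ.trans_le hψN))]; exact inv_anti₀ hγ hψN
  have hh' : |(T4GaugeActionRate.psi163 (R * N) s)⁻¹| ≤ (T4GaugeActionRate.gam0 d)⁻¹ := by
    rw [abs_of_pos (inv_pos.mpr (hγ.trans_le hψRN))]; exact inv_anti₀ hγ hψRN
  have rh : |(T4GaugeActionRate.psi163 N s)⁻¹ - (T4GaugeActionRate.psi163 (R * N) s)⁻¹|
      ≤ (T4GaugeActionRate.gam0 d ^ 2)⁻¹ * (4 * d * Cpsi * ((N : ℝ) ^ 2)⁻¹) := by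
    have := B5ActionRate166.inv_psi163_rate hN hR s hs ν₀ hν₀
    simpa only [one_div] using this
  -- factor k = (Δ₀φ)⁻¹
  obtain ⟨k0, k1⟩ := inv_D0phi_bounds hN a ha μ hs ν₀ hν₀
  obtain ⟨k0', k1'⟩ := inv_D0phi_bounds hRN a ha μ hs ν₀ hν₀
  have hk : |(Delta1r 0 s * phiMu N a μ s)⁻¹| ≤ 1 / (a * T4GaugeActionRate.gam0 d) := by
    rwa [abs_of_pos k0]
  have hk' : |(Delta1r 0 s * phiMu (R * N) a μ s)⁻¹| ≤ 1 / (a * T4GaugeActionRate.gam0 d) := by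
    rwa [abs_of_pos k0']
  have rk := inv_D0phi_rate hN hR a ha μ hs ν₀ hν₀
  -- factor B = BrP
  have hB : |BrP N a μ s| ≤ MBr d a := by unfold MBr; exact BrP_abs_le hN a ha μ hs
  have rB := BrP_rate hN hR a ha μ hs ν₀ hν₀
  -- chain
  have s1 := rate_mul_real hg' hh rg rh
  have m2 : |(Delta1r 0 s / DeltaXir (R * N) 0 s) ^ 2 * (T4GaugeActionRate.psi163 (R * N) s)⁻¹|
      ≤ 1 * (T4GaugeActionRate.gam0 d)⁻¹ := by
    rw [abs_mul]; exact mul_le_mul hg' hh' (abs_nonneg _) zero_le_one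
  have s2 := rate_mul_real m2 hk s1 rk
  have m3 : |(Delta1r 0 s / DeltaXir (R * N) 0 s) ^ 2 * (T4GaugeActionRate.psi163 (R * N) s)⁻¹
        * (Delta1r 0 s * phiMu (R * N) a μ s)⁻¹|
      ≤ 1 * (T4GaugeActionRate.gam0 d)⁻¹ * (1 / (a * T4GaugeActionRate.gam0 d)) := by
    rw [abs_mul]; exact mul_le_mul m2 hk' (abs_nonneg _) (by positivity)
  have s3 := rate_mul_real m3 hB s2 rB
  unfold rS
  refine s3.trans (le_of_eq ?_)
  unfold CrS
  field_simp

/-- `|rS| ≤ MrS`. [folklore] -/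
theorem rS_abs_le' {n : ℕ} [NeZero n] (hn : 1 ≤ n) (a : ℝ) (ha : 0 < a) (μ : Fin d) {s : Fin d → ℝ}
    (hs : ∀ ν, |s ν| ≤ Real.pi) (ν₀ : Fin d) (hν₀ : s ν₀ ≠ 0) : |rS n a μ s| ≤ MrS d a := by
  unfold MrS; exact rS_abs_le hn a ha μ hs ν₀ hν₀

/-- `‖bR_μ(p′)‖ ≤ |p′_μ|·MrS`. [folklore] -/
theorem norm_bR_zero_le' {n : ℕ} [NeZero n] (hn : 1 ≤ n) (a : ℝ) (ha : 0 < a) (μ : Fin d)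
    {s : Fin d → ℝ} (hs : ∀ ν, |s ν| ≤ Real.pi) (hs0 : s ≠ 0) : ‖bR n a μ s s‖ ≤ |s μ| * MrS d a := by
  unfold MrS; exact norm_bR_zero_le hn a ha μ hs hs0

/-- **η-RATE OF THE ZONE-CENTRE BRACKET `bR_μ(p′)`** in its printed (1.88) form `conj D(p′_μ)·ū(p′)·rS`
(second order in the scalar, first order in `D`, `ū`): relative rate `(1 + (π/2)^{d+1})·|p′|₁/N + (CrS/MrS)·N⁻²` against the
majorant `|p′_μ|·MrS`. [cite: Balaban1984PropagatorsI, (1.88) p.32; King1986, p.673] [folklore] -/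
theorem bR_zero_rate (hN : 1 ≤ N) (hR : 1 ≤ R) (a : ℝ) (ha : 0 < a) (μ : Fin d) {s : Fin d → ℝ}
    (hs : ∀ ν, |s ν| ≤ Real.pi) (hs0 : s ≠ 0) :
    ‖bR N a μ s s - bR (R * N) a μ s s‖
      ≤ ((1 + (Real.pi / 2) ^ (d + 1)) * ((∑ ν, |s ν|) / N)
          + CrS d a (Delta1r 0 s) / MrS d a * ((N : ℝ) ^ 2)⁻¹) * (|s μ| * MrS d a) := by
  obtain ⟨ν₀, hν₀⟩ : ∃ ν, s ν ≠ 0 := Function.ne_iff.mp hs0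
  have hRN := one_le_RN hN hR
  have hπ := Real.pi_pos
  have hsN := zone_of_centre hN hs
  have hsRN := zone_of_centre hRN hs
  have hM := MrS_pos d ha
  have hN0 : (0 : ℝ) < N := by exact_mod_cast hN
  have hε0 : 0 ≤ (∑ ν, |s ν|) / (N : ℝ) := by positivity
  rw [bR_zero_eq hN a ha s hs hs0 μ, bR_zero_eq hRN a ha s hs hs0 μ]
  have hF : ‖conj (fdq ((N : ℝ)⁻¹) (s μ))‖ ≤ |s μ| := norm_conj_fdq_le hN (s μ)
  have hU : ‖uWeight ((N : ℝ)⁻¹) s‖ ≤ 1 := norm_uWeight_le_one hN hsN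
  have hU' : ‖uWeight (((R * N : ℕ) : ℝ)⁻¹) s‖ ≤ 1 := norm_uWeight_le_one hRN hsRN
  have hr' : ‖((rS (R * N) a μ s : ℝ) : ℂ)‖ ≤ MrS d a := by
    rw [Complex.norm_real, Real.norm_eq_abs]; exact rS_abs_le' hRN a ha μ hs ν₀ hν₀
  have rF : ‖conj (fdq ((N : ℝ)⁻¹) (s μ)) - conj (fdq (((R * N : ℕ) : ℝ)⁻¹) (s μ))‖
      ≤ (1 * ((∑ ν, |s ν|) / N)) * |s μ| := by
    rw [← map_sub, Complex.norm_conj]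
    refine (fdq_rate hN hR (s μ)).trans ?_
    have h1 : |s μ| / N ≤ (∑ ν, |s ν|) / N := div_le_div_of_nonneg_right (abs_le_sum_abs s μ) hN0.le
    rw [one_mul]; exact mul_le_mul_of_nonneg_right h1 (abs_nonneg _)
  have rU : ‖uWeight ((N : ℝ)⁻¹) s - uWeight (((R * N : ℕ) : ℝ)⁻¹) s‖
      ≤ ((Real.pi / 2) ^ (d + 1) * ((∑ ν, |s ν|) / N)) * 1 :=
    (uWeight_rate hN hR hsN).trans (mul_le_mul_of_nonneg_left hU (by positivity))
  have rr : ‖((rS N a μ s : ℝ) : ℂ) - ((rS (R * N) a μ s : ℝ) : ℂ)‖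
      ≤ (CrS d a (Delta1r 0 s) * ((N : ℝ) ^ 2)⁻¹ / MrS d a) * MrS d a := by
    rw [← Complex.ofReal_sub, Complex.norm_real, Real.norm_eq_abs, div_mul_cancel₀ _ hM.ne']
    exact rS_rate hN hR a ha μ hs ν₀ hν₀
  have step1 := rate_mul hF hU' rF rU (by positivity)
  have hFU : ‖conj (fdq ((N : ℝ)⁻¹) (s μ)) * uWeight ((N : ℝ)⁻¹) s‖ ≤ |s μ| * 1 := norm_mul_le_of_le hF hU
  have step2 := rate_mul hFU hr' step1 rr (by positivity)
  refine step2.trans (le_of_eq ?_)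
  ring

/-- the rank-one ENTRY rate at `(l, l′) = (0, 0)`. [folklore] -/
theorem rankOne_rate_zero_zero (hN : 1 ≤ N) (hR : 1 ≤ R) (a : ℝ) (ha : 0 < a) {s : Fin d → ℝ}
    (hs : ∀ ν, |s ν| ≤ Real.pi) (hs0 : s ≠ 0) (μ ν : Fin d) :
    ‖((cB N a s : ℝ) : ℂ) * bR N a μ s s * conj (bR N a ν s s)
        - ((cB (R * N) a s : ℝ) : ℂ) * bR (R * N) a μ s s * conj (bR (R * N) a ν s s)‖
      ≤ (4 * d * Cphi / T4GaugeActionRate.gam0 d ^ 2 * ((N : ℝ) ^ 2)⁻¹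
            + ((1 + (Real.pi / 2) ^ (d + 1)) * ((∑ κ, |s κ|) / N)
                + CrS d a (Delta1r 0 s) / MrS d a * ((N : ℝ) ^ 2)⁻¹)
            + ((1 + (Real.pi / 2) ^ (d + 1)) * ((∑ κ, |s κ|) / N)
                + CrS d a (Delta1r 0 s) / MrS d a * ((N : ℝ) ^ 2)⁻¹))
          * ((4 * d + a) / a * (|s μ| * MrS d a) * (|s ν| * MrS d a)) := by
  obtain ⟨ν₀, hν₀⟩ : ∃ κ, s κ ≠ 0 := Function.ne_iff.mp hs0
  have hRN := one_le_RN hN hR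
  have hπ := Real.pi_pos
  have hM := MrS_pos d ha
  have hC := (CrS_nonneg_mono d ha (Delta1r_nonneg 0 le_rfl s) le_rfl).1
  exact rankOne_rate_of hN hR a ha hs ν₀ hν₀ (norm_bR_zero_le' hN a ha μ hs hs0)
    (norm_bR_zero_le' hRN a ha μ hs hs0) (norm_bR_zero_le' hRN a ha ν hs hs0)
    (bR_zero_rate hN hR a ha μ hs hs0) (bR_zero_rate hN hR a ha ν hs hs0) (by positivity)

/-- the rank-one ENTRY rate at `(l, l′) = (0, l′)`, `l′` any alias (majorant `bMajA` on the right). [folklore] -/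
theorem rankOne_rate_zero_alias (hN : 1 ≤ N) (hR : 1 ≤ R) (a : ℝ) (ha : 0 < a) {s q' : Fin d → ℝ}
    (hs : ∀ ν, |s ν| ≤ Real.pi) (hs0 : s ≠ 0) (μ ν : Fin d)
    (hq' : ∀ κ, |q' κ| ≤ Real.pi * N) (hrep' : ∀ κ, ∃ m : ℤ, q' κ = s κ + 2 * Real.pi * m) :
    ‖((cB N a s : ℝ) : ℂ) * bR N a μ s s * conj (bR N a ν q' s)
        - ((cB (R * N) a s : ℝ) : ℂ) * bR (R * N) a μ s s * conj (bR (R * N) a ν q' s)‖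
      ≤ (4 * d * Cphi / T4GaugeActionRate.gam0 d ^ 2 * ((N : ℝ) ^ 2)⁻¹
            + ((1 + (Real.pi / 2) ^ (d + 1)) * ((∑ κ, |s κ|) / N)
                + CrS d a (Delta1r 0 s) / MrS d a * ((N : ℝ) ^ 2)⁻¹)
            + (Ab d * ((∑ κ, |q' κ|) / N) + Bb d * ((N : ℝ) ^ 2)⁻¹))
          * ((4 * d + a) / a * (|s μ| * MrS d a) * bMajA d s q' ν) := by
  obtain ⟨ν₀, hν₀⟩ : ∃ κ, s κ ≠ 0 := Function.ne_iff.mp hs0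
  have hRN := one_le_RN hN hR
  have hqRN' : ∀ κ, |q' κ| ≤ Real.pi * (R * N : ℕ) := fun κ => zone_RN hR (hq' κ)
  have hπ := Real.pi_pos
  have hM := MrS_pos d ha
  have hC := (CrS_nonneg_mono d ha (Delta1r_nonneg 0 le_rfl s) le_rfl).1
  exact rankOne_rate_of hN hR a ha hs ν₀ hν₀ (norm_bR_zero_le' hN a ha μ hs hs0)
    (norm_bR_zero_le' hRN a ha μ hs hs0) (norm_bR_le_alias hRN a ha hs ν₀ hν₀ hqRN' hrep' ν)
    (bR_zero_rate hN hR a ha μ hs hs0) (bR_rate_alias hN hR a ha ν hs ν₀ hν₀ hq' hrep') (by positivity)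

/-- the rank-one ENTRY rate at `(l, l′) = (l, 0)`, `l` any alias (majorant `bMajA` on the left). [folklore] -/
theorem rankOne_rate_alias_zero (hN : 1 ≤ N) (hR : 1 ≤ R) (a : ℝ) (ha : 0 < a) {s q : Fin d → ℝ}
    (hs : ∀ ν, |s ν| ≤ Real.pi) (hs0 : s ≠ 0) (μ ν : Fin d)
    (hq : ∀ κ, |q κ| ≤ Real.pi * N) (hrep : ∀ κ, ∃ m : ℤ, q κ = s κ + 2 * Real.pi * m) :
    ‖((cB N a s : ℝ) : ℂ) * bR N a μ q s * conj (bR N a ν s s)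
        - ((cB (R * N) a s : ℝ) : ℂ) * bR (R * N) a μ q s * conj (bR (R * N) a ν s s)‖
      ≤ (4 * d * Cphi / T4GaugeActionRate.gam0 d ^ 2 * ((N : ℝ) ^ 2)⁻¹
            + (Ab d * ((∑ κ, |q κ|) / N) + Bb d * ((N : ℝ) ^ 2)⁻¹)
            + ((1 + (Real.pi / 2) ^ (d + 1)) * ((∑ κ, |s κ|) / N)
                + CrS d a (Delta1r 0 s) / MrS d a * ((N : ℝ) ^ 2)⁻¹))
          * ((4 * d + a) / a * bMajA d s q μ * (|s ν| * MrS d a)) := by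
  obtain ⟨ν₀, hν₀⟩ : ∃ κ, s κ ≠ 0 := Function.ne_iff.mp hs0
  have hRN := one_le_RN hN hR
  have hqRN : ∀ κ, |q κ| ≤ Real.pi * (R * N : ℕ) := fun κ => zone_RN hR (hq κ)
  have hπ := Real.pi_pos
  have hγ := T4GaugeActionRate.gam0_pos d
  have hCφ := B5ActionRate166.Cphi_pos
  have hCψ := B5ActionRate166.Cpsi_pos
  have hAb : 0 ≤ Ab d := by unfold Ab; positivity
  have hBb : 0 ≤ Bb d := by unfold Bb; positivity
  exact rankOne_rate_of hN hR a ha hs ν₀ hν₀ (norm_bR_le_alias hN a ha hs ν₀ hν₀ hq hrep μ)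
    (norm_bR_le_alias hRN a ha hs ν₀ hν₀ hqRN hrep μ) (norm_bR_zero_le' hRN a ha ν hs hs0)
    (bR_rate_alias hN hR a ha μ hs ν₀ hν₀ hq hrep) (bR_zero_rate hN hR a ha ν hs hs0) (by positivity)

end Rates

end Literature.MathematicalPhysics.QuantumFieldTheory.Balaban1983to89.B5G183Rate

end
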